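import Summits.SmoothPoincare4.SmoothPoincare4.Theorems.ConvexBisectionAcyclicBisectionExistsT3AssemblyGlue
import Summits.SmoothPoincare4.SmoothPoincare4.Theorems.ConvexBisectionAcyclicBisectionExistsPushedPrefixEmbedding
import Summits.SmoothPoincare4.SmoothPoincare4.Theorems.ConvexBisectionAcyclicBisectionExistsDualHandleCompatibleSplit
import Summits.SmoothPoincare4.SmoothPoincare4.Theorems.ConvexBisectionAcyclicBisectionExistsDualHandleStandardForm
import Summits.SmoothPoincare4.SmoothPoincare4.Theorems.ConvexBisectionAcyclicBisectionExistsDualHandleModelEmbedding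
import Summits.SmoothPoincare4.SmoothPoincare4.Theorems.ConvexBisectionAcyclicBisectionExistsDualLinkNodes
import Summits.SmoothPoincare4.SmoothPoincare4.Theorems.ConvexBisectionAcyclicBisectionExistsBeltPushoffAssembly
import Summits.SmoothPoincare4.SmoothPoincare4.Theorems.ConvexBisectionAcyclicBisectionExistsSeamTransportAssembly
import Summits.SmoothPoincare4.SmoothPoincare4.Theorems.ConvexBisectionAcyclicBisectionExistsStubModelsOnCounts
import Summits.SmoothPoincare4.SmoothPoincare4.Theorems.ConvexBisectionAcyclicBisectionExistsDualDataHandle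
import Summits.SmoothPoincare4.SmoothPoincare4.Theorems.ConvexBisectionAcyclicBisectionExistsBeltPageClause
import Summits.SmoothPoincare4.SmoothPoincare4.Theorems.ConvexBisectionAcyclicBisectionExistsOrseamSignPin
import Summits.SmoothPoincare4.SmoothPoincare4.Theorems.ConvexBisectionAcyclicBisectionExistsDualBind
import Summits.SmoothPoincare4.SmoothPoincare4.Theorems.ConvexBisectionAcyclicBisectionExistsBoundaryConnected
import Literature.Geometry.Symplectic.LefschetzSteinOpenBook
import HarnessLib

/-!
# Dual handles, T3: THE T3 CONTRACT — `stub_T3_dualPresentation` from its seven bricks, kernel-checked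
(sub-goal of stub `stub_T3_dualPresentation` (T3), line `modp-braid-orbits` r12, crux
`ConvexBisection.AcyclicBisectionExists`, item stmt-SmoothPoincare4-10508; wave 5, lead c5, worker X2;
registered sub-goal `helper_mem_range_prefix_or_suffix`)

`T3_of_pieces`: the registered text of `stub_T3_dualPresentation` (= the antecedent of the landed NF6
reduction `helper_steinRealisation_of_nodes`, Baykur 2006 proof of Thm. 5.1) PROVED from seven
`∀`-statements taken as hypotheses VERBATIM (no `def … : Prop`), each the target of one wave-5 worker
(texts agreed in `work/stubs/X2_interfaces.lean` V2 / `X<k>X2_interface.lean`):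

* `Hiv`   (X1) the dual multi-attachment data `D₂` on Y6's concrete complement piece, with its export
  clauses (E1) `E = j_N` at points with shallow dual-tube coordinates (`lamSq < 1/4`; closed up in §1b)
  and (E2) the dual handles in the glued handle chart — X1's registered `helper_exists_dualAttachmentData`;
* `HST4`  (X3) the global twisting sign of the seam map (`node_ST4_twistSign`), consumed through Y3's
  landed contract `node_seam_transport_of_twistSign` and Z7's landed node
  `node_dualLink_pageLink_of_universal_nodes` (with Y1's landed `helper_belt_isotopic_pushoff`);
* `Hgap`  (unassigned in wave 5) "T3c-3 WITH DATA": a page presentation WITH DATA of the complement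
  piece, one seam point with its orientation character, and the two bridges to `D₂`;
* `Hsign` (X4) the sign pin through the base reflection `σ` and the ORSEAM frame (T3 (i) + (iv)) —
  LANDED `helper_dualPresentation_signPin`, plugged in by `T3_of_four_pieces` (§3);
* `HF`    (X5) the seam page function (T3 (ii)) for `(D₁, D₂)`;
* `Hbind` (X6) binding points are `W₂`-unsurgered (T3 (iii)) for `(D₁, D₂)` — LANDED `T3_bind`, plugged in (§3);
* `Hconn` (X6) `∂X₁` is connected (T3 (v)) — LANDED `helper_T3_connected`, plugged in (§3).

The assembly itself (§2) is: `ModelsOnFibred` ▸ V5 compatible split ▸ V5 standard form (`Ψ := G.φ`) ▸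
constants `κ ≤ κ₀` (X6), `aδ ≤ 1/5` (X1) ▸ Y5 pushed prefix embedding ▸ Y6 complement piece on the
concrete regular sublevel set (`exists_complementPiece_concrete`) ▸ `Hiv` ▸ THE SEAM CLAUSE
(`seam_clause_shallow` of `…T3AssemblyGlue.lean`) ▸ T3c-3 ▸ `Hgap` ▸ `Hsign` ▸ bridges (R1)(R2) along `τ`
(`mem_coresComplement_of_transport_invol`) ▸ `HF` (its extra inputs built in place: §1
`mem_range_prefix_or_suffix`, (E1) off the ranges, (F1) through X1's (E2) and Y6's `gluedHandleChart_coe`,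
V4's belt clause), `Hbind`, `Hconn` ▸ the T3 text.

Everything here is proved; the seven bricks enter as hypotheses; no `sorry`.

## References
* R. İ. Baykur, *Kähler decomposition of 4-manifolds*, AGT 6 (2006), proof of Thm. 5.1. [Baykur2006]
* J. Milnor, *Lectures on the h-cobordism theorem* (1965), §3. [MilnorHCobordism1965]
* A. Kosinski, *Differential Manifolds* (1993), VI §6. [Kosinski1993]
-/

noncomputable section

-- the prescribed namespace `Summit.<P>.<Sub>.…` duplicates `SmoothPoincare4` (P = Sub)
set_option linter.dupNamespace false

open scoped Manifold ContDiff Topology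

namespace Summit.SmoothPoincare4.SmoothPoincare4.Theorems.AcyclicBisectionExists.ModpBraidOrbits

open Set Function Metric Filter Topology
open Literature.Topology.FourManifolds Literature.Topology.FourManifolds.HandleAttachingMap
  Literature.Topology.FourManifolds.LefschetzBase Literature.Geometry.Symplectic

/-! ### §1 Bookkeeping: every index of `P ++ N` is a prefix or a suffix index -/

/-- **Every index of `Fin (P ++ N).length` is a prefix index `Fin.cast _ (Fin.castAdd |N| i)` or a suffix
index `Fin.cast _ (Fin.natAdd |P| j)`** (the joint surjectivity consumed by the seam page function).
[folklore] -/
theorem mem_range_prefix_or_suffix {α : Type} (P N : List α) (i : Fin (P ++ N).length) :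
    i ∈ range (fun i : Fin P.length => Fin.cast List.length_append.symm (Fin.castAdd N.length i)) ∨
      i ∈ range (fun j : Fin N.length => Fin.cast List.length_append.symm (Fin.natAdd P.length j)) := by
  by_cases hi : (i : ℕ) < P.length
  · exact Or.inl ⟨⟨i, hi⟩, Fin.ext rfl⟩
  · refine Or.inr ⟨⟨(i : ℕ) - P.length, ?_⟩, Fin.ext ?_⟩
    · have h1 := i.2
      have h2 : (P ++ N).length = P.length + N.length := List.length_append
      omega
    · simp only [Fin.val_cast, Fin.val_natAdd]; omega

/-! ### §1b From X1's strict export clause (E1) to the closed one -/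

/-- **The export clause (E1) passes to the closed condition.**  If a continuous `E` on the complement
of the cores of a family `q` with pairwise disjoint ranges agrees with a continuous `J` at every point all
of whose tube coordinates have `lamSq < 1/4`, then also at every point all of whose tube coordinates have
`lamSq ≤ 1/4`: such a point with a coordinate `y₀`, `lamSq y₀ = 1/4`, is the limit of the points with
coordinates `c • y₀,λ + y₀,μ`, `c ↑ 1`, and `{E = J}` is closed. [folklore] -/
theorem apply_eq_of_forall_lamSq_le {W : Type} [TopologicalSpace W] [T2Space W]
    [ChartedSpace (EuclideanHalfSpace 4) W] {ι' : Type} [Finite ι'] (q : ι' → HandleAttachingMap 3 2 W)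
    (hdisj : Pairwise fun i j => Disjoint (range (q i).toFun) (range (q j).toFun))
    {Y : Type} [TopologicalSpace Y] [T2Space Y] (E : ↥(coresComplement q) → Y) (hE : Continuous E)
    (J : W → Y) (hJ : Continuous J)
    (hlt : ∀ w : ↥(coresComplement q), (∀ (j : ι') (y : ↥(handleTube 3 2)), (q j).toFun y = (w : W) →
      lamSq 2 ((y : closedBall (0 : EuclideanSpace ℝ (Fin 4)) 1) : EuclideanSpace ℝ (Fin 4)) < 1 / 4) → E w = J w)
    (w : ↥(coresComplement q)) (hw : ∀ (j : ι') (y : ↥(handleTube 3 2)), (q j).toFun y = (w : W) →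
      lamSq 2 ((y : closedBall (0 : EuclideanSpace ℝ (Fin 4)) 1) : EuclideanSpace ℝ (Fin 4)) ≤ 1 / 4) :
    E w = J w := by
  by_cases hall : ∀ (j : ι') (y : ↥(handleTube 3 2)), (q j).toFun y = (w : W) →
      lamSq 2 ((y : closedBall (0 : EuclideanSpace ℝ (Fin 4)) 1) : EuclideanSpace ℝ (Fin 4)) < 1 / 4
  · exact hlt w hall
  push Not at hall
  obtain ⟨j, y₀, hy₀, hge⟩ := hall
  have h14 : lamSq 2 ((y₀ : closedBall (0 : EuclideanSpace ℝ (Fin 4)) 1) : EuclideanSpace ℝ (Fin 4)) = 1 / 4 :=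
    le_antisymm (hw j y₀ hy₀) hge
  -- the curve `c ↦ c • y₀,λ + y₀,μ`
  set v₀ : EuclideanSpace ℝ (Fin 4) := ((y₀ : closedBall (0 : EuclideanSpace ℝ (Fin 4)) 1) : EuclideanSpace ℝ (Fin 4))
    with hv₀
  let x : ℝ → EuclideanSpace ℝ (Fin 4) := fun c => c • lamEmbed (lamPart v₀) + muEmbed (muPart v₀)
  have hxc : Continuous x := (continuous_id.smul continuous_const).add continuous_const
  have hlam : ∀ c, lamPart (x c) = c • lamPart v₀ := fun c => by
    simp only [x, lamPart_add, lamPart_smul, lamPart_lamEmbed, lamPart_muEmbed, add_zero]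
  have hmu : ∀ c, muPart (x c) = muPart v₀ := fun c => by
    simp only [x, muPart_add, muPart_smul, muPart_lamEmbed, muPart_muEmbed, smul_zero, zero_add]
  have hlamSq : ∀ c, lamSq 2 (x c) = c ^ 2 * (1 / 4) := fun c => by
    rw [← norm_lamPart_sq, hlam, norm_smul, mul_pow, Real.norm_eq_abs, sq_abs, norm_lamPart_sq, h14]
  have hnorm : ∀ c, c ^ 2 ≤ 1 → ‖x c‖ ≤ 1 := fun c hc => by
    have h1 : ‖x c‖ ^ 2 = c ^ 2 * (1 / 4) + ‖muPart v₀‖ ^ 2 := by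
      rw [← lamSq_add_muSq 2 (x c), hlamSq, ← norm_muPart_sq, hmu]
    have h2 : (1 : ℝ) / 4 + ‖muPart v₀‖ ^ 2 = ‖v₀‖ ^ 2 := by
      rw [← lamSq_add_muSq 2 v₀, ← norm_muPart_sq, h14]
    have h3 : ‖v₀‖ ≤ 1 := mem_closedBall_zero_iff.1 (y₀ : closedBall (0 : EuclideanSpace ℝ (Fin 4)) 1).2
    nlinarith [norm_nonneg (x c), norm_nonneg v₀, sq_nonneg ‖muPart v₀‖]
  -- the sequence of tube points `yₙ = x (1 - 1/(n+2))`
  let c : ℕ → ℝ := fun n => 1 - ((n : ℝ) + 2)⁻¹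
  have hc01 : ∀ n, 0 < c n ∧ c n < 1 := fun n => by
    have h2 : (1 : ℝ) < (n : ℝ) + 2 := by have := Nat.cast_nonneg (α := ℝ) n; linarith
    have hinv1 : ((n : ℝ) + 2)⁻¹ < 1 := inv_lt_one_of_one_lt₀ h2
    have hinv0 : 0 < ((n : ℝ) + 2)⁻¹ := by positivity
    exact ⟨by show 0 < 1 - ((n : ℝ) + 2)⁻¹; linarith, by show 1 - ((n : ℝ) + 2)⁻¹ < 1; linarith⟩
  have hcsq : ∀ n, (c n) ^ 2 < 1 := fun n => by
    have := hc01 n; nlinarith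
  let yv : ℕ → ↥(handleTube 3 2) := fun n =>
    ⟨⟨x (c n), mem_closedBall_zero_iff.2 (hnorm _ (hcsq n).le)⟩, by
      rw [mem_handleTube]
      show lamSq 2 (x (c n)) ≠ 0
      rw [hlamSq]; have := (hc01 n).1; positivity⟩
  have hylam : ∀ n, lamSq 2 (((yv n : ↥(handleTube 3 2)) : closedBall (0 : EuclideanSpace ℝ (Fin 4)) 1) :
      EuclideanSpace ℝ (Fin 4)) < 1 / 4 := fun n => by
    show lamSq 2 (x (c n)) < 1 / 4
    rw [hlamSq]; nlinarith [hcsq n]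
  -- the points `wₙ = q j yₙ` of the cores complement, each with the single shallow coordinate `yₙ`
  have hmem : ∀ n, (q j).toFun (yv n) ∈ coresComplement q := fun n =>
    (apply_mem_coresComplement_iff hdisj j (yv n)).2 (by have := hylam n; exact ne_of_lt (by linarith))
  have hEq : ∀ n, E ⟨(q j).toFun (yv n), hmem n⟩ = J ((q j).toFun (yv n)) := fun n => by
    refine hlt _ fun j' y' hy' => ?_
    have hjj : j' = j := index_eq_of_apply_eq hdisj hy'
    subst hjj
    have hyy : y' = yv n := (q j').isSmoothEmbedding.isEmbedding.injective hy'
    rw [hyy]; exact hylam n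
  -- `yₙ → y₀`, hence `wₙ → w`
  have hc1 : Tendsto c atTop (𝓝 1) := by
    have h0 : Tendsto (fun n : ℕ => ((n : ℝ) + 2)⁻¹) atTop (𝓝 0) :=
      (tendsto_atTop_add_const_right _ _ tendsto_natCast_atTop_atTop).inv_tendsto_atTop
    simpa using (tendsto_const_nhds (x := (1 : ℝ))).sub h0
  have hx1 : x 1 = v₀ := by simp only [x, one_smul]; exact lamEmbed_add_muEmbed v₀
  have hyt : Tendsto yv atTop (𝓝 y₀) := by
    rw [tendsto_subtype_rng, tendsto_subtype_rng]
    show Tendsto (fun n => x (c n)) atTop (𝓝 v₀)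
    rw [← hx1]
    exact (hxc.tendsto 1).comp hc1
  have hwt : Tendsto (fun n => (⟨(q j).toFun (yv n), hmem n⟩ : ↥(coresComplement q))) atTop (𝓝 w) := by
    rw [tendsto_subtype_rng]
    show Tendsto (fun n => (q j).toFun (yv n)) atTop (𝓝 (w : W))
    rw [← hy₀]
    exact ((q j).isSmoothEmbedding.isEmbedding.continuous.tendsto y₀).comp hyt
  -- `{E = J}` is closed
  exact (isClosed_eq hE (hJ.comp continuous_subtype_val)).mem_of_tendsto hwt (Eventually.of_forall hEq)

/-! ### §2 The T3 contract -/

set_option maxHeartbeats 800000 in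
-- the two `τ`-bridges elaborate against a context of ~90 hypotheses with long dependent types
/-- **THE T3 CONTRACT (`stub_T3_dualPresentation` from its seven bricks).**  The registered text of
`stub_T3_dualPresentation` — from a sorted fibred model `ModelsOnFibred M g (P ++ N)` with `N` negative
and all classes non-zero: the Lefschetz link, the prefix sub-handlebody `X₁` with data `D₁`, the
complement piece `W₂` with `M = X₁ ∪_φ W₂`, a positive allowable presentation `(h₂, D₂)` of `W₂` over
the cap, the seam page function `F`, the binding clause, the ORSEAM point and connectedness of the
seam — PROVED from the seven worker statements `Hiv` (X1), `HST4` (X3), `Hgap` (unassigned),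
`Hsign` (X4), `HF` (X5), `Hbind`, `Hconn` (X6) taken verbatim as hypotheses; see the file header for
the assembly. [cite: Baykur2006, Thm. 5.1 (proof, pp. 13–14)] -/
theorem T3_of_pieces
    (Hiv : ∀ {B : Type} [TopologicalSpace B] [T2Space B] [ChartedSpace (EuclideanHalfSpace 4) B] {ι : Type} [Finite ι] {h : ι → Literature.Topology.FourManifolds.HandleAttachingMap 3 2 B} {X : Type} [TopologicalSpace X] [ChartedSpace (EuclideanHalfSpace 4) X] [IsManifold (𝓡∂ 4) ∞ X] (D : Literature.Topology.FourManifolds.HandleAttachingMap.MultiAttachmentData h (𝓡∂ 4) X) {ι' : Type} [Finite ι'] (f : ι' → ι) {bX : Literature.Topology.FourManifolds.BoundaryData (𝓡∂ 4) X (𝓡 3)} {W : Type} [TopologicalSpace W] [ChartedSpace (EuclideanHalfSpace 4) W] [IsManifold (𝓡∂ 4) ∞ W] {bW : Literature.Topology.FourManifolds.BoundaryData (𝓡∂ 4) W (𝓡 3)} [Nonempty bX.carrier] (G : Literature.Topology.FourManifolds.BoundaryGlueData bX bW) {a κ δ : ℝ} [CompactSpace X] [T2Space X] [T2Space W] [CompactSpace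 W] (col : (Literature.Topology.FourManifolds.BoundaryManifold.boundaryData 3 W).Collar) (ha : 0 < a) (hf : Function.Injective f) (hCM : ∀ j, Summit.SmoothPoincare4.SmoothPoincare4.Theorems.AcyclicBisectionExists.ModpBraidOrbits.CollarAdapted D (f j) G a) (hκ : 0 < κ) (hκ2 : κ ≤ 1 / 2) (hκ1 : κ ≤ 1) (hδ : 0 < δ) (hδ2 : δ ≤ 1 / 2), a * δ ≤ 1 / 5 → (∀ (w : (Literature.Topology.FourManifolds.BoundaryManifold.boundaryData 3 W).carrier) (x : bW.carrier), (Literature.Topology.FourManifolds.BoundaryManifold.boundaryData 3 W).incl w = bW.incl x → ∀ t : Set.Icc (0 : ℝ) 1, col.toFun (w, t) = G.CN.toFun x ((t : ℝ) / (2 - t))) → ∀ (hΦ : Literature.Topology.FourManifolds.IsRegularLevel (𝓡 4) (Summit.SmoothPoincare4.SmoothPoincare4.Theorems.AcyclicBisectionExists.ModpBraidOrbits.levelFn D f G a κ δ) 0), ∃ D₂ : Literature.Topology.FourManifolds.HandleAttachingMap.MultiAttachmentData (fun j : ι' => Summit.SmoothPoincare4.SmoothPoincare4.Theorems.AcyclicBisectionExists.ModpBraidOrbits.dualMap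 D bX bW G.φ col κ δ hκ hκ1 hδ hδ2 (f j)) (𝓡∂ 4) (Literature.Topology.FourManifolds.RegularSublevel hΦ), (∀ w : ↥(Literature.Topology.FourManifolds.HandleAttachingMap.coresComplement (fun j : ι' => Summit.SmoothPoincare4.SmoothPoincare4.Theorems.AcyclicBisectionExists.ModpBraidOrbits.dualMap D bX bW G.φ col κ δ hκ hκ1 hδ hδ2 (f j))), (∀ (j : ι') (y : ↥(Literature.Topology.FourManifolds.handleTube 3 2)), (Summit.SmoothPoincare4.SmoothPoincare4.Theorems.AcyclicBisectionExists.ModpBraidOrbits.dualMap D bX bW G.φ col κ δ hκ hκ1 hδ hδ2 (f j)).toFun y = (w : W) → Literature.Topology.FourManifolds.lamSq 2 ((y : Metric.closedBall (0 : EuclideanSpace ℝ (Fin 4)) 1) : EuclideanSpace ℝ (Fin 4)) < 1 / 4) → Literature.Topology.FourManifolds.RegularSublevel.incl hΦ (D₂.jA w) = G.jN w) ∧ (∀ (j : ι') (b : ↥(Literature.Topology.FourManifolds.beltPiece 3 2)), Literature.Topology.FourManifolds.RegularSublevel.incl hΦ (D₂.jB j b) = Summit.SmoothPoincare4.SmoothPoincare4.Theorems.AcyclicBisectionExists.ModpBraidOrbits.gluedHandleChart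 D (f j) G a (Summit.SmoothPoincare4.SmoothPoincare4.Theorems.AcyclicBisectionExists.ModpBraidOrbits.modelF a κ δ ((b : Metric.closedBall (0 : EuclideanSpace ℝ (Fin 4)) 1) : EuclideanSpace ℝ (Fin 4)))))
    (HST4 : ∀ (g : ℕ) (l : List ((Fin g ⊕ Fin g → ℤ) × Bool)) (h : Fin l.length → HandleAttachingMap 3 2 (Base g)) (hlink : IsLefschetzLink g l h) {X : Type} [TopologicalSpace X] [T2Space X] [SecondCountableTopology X] [CompactSpace X] [ChartedSpace (EuclideanHalfSpace 4) X] [IsManifold (𝓡∂ 4) ∞ X] (D : MultiAttachmentData h (𝓡∂ 4) X) (bX : BoundaryData (𝓡∂ 4) X (𝓡 3)) (Ψ : bX.carrier ≃ₘ⟮𝓡 3, 𝓡 3⟯ (bBase g).carrier) (hpage : ∀ (y : bX.carrier) (a : ↥(coresComplement h)), bX.incl y = D.jA a → ∃ c : ℝ, 0 < c ∧ w g ((bBase g).incl (Ψ y)).1 = (c : ℂ) * w g (a : Base g).1), ∃ s₀ : ℤ, (s₀ = 1 ∨ s₀ = -1) ∧ ∀ (c : ℂ) (_ : ‖c‖ =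 1) (K : sphere (0 : EuclideanSpace ℝ (Fin 2)) 1 → Base g) (ν : sphere (0 : EuclideanSpace ℝ (Fin 2)) 1 → EuclideanSpace ℝ (Fin 4)) (hK : ∀ θ, K θ ∈ coresComplement h) (_ : ∀ θ, K θ ∈ page g c) (_ : IsBoundaryKnot K) (_ : IsKnotFraming K ν) (z : sphere (0 : EuclideanSpace ℝ (Fin 2)) 1 → bX.carrier) (_ : ∀ θ, bX.incl (z θ) = D.jA ⟨K θ, hK θ⟩) (u : sphere (0 : EuclideanSpace ℝ (Fin 2)) 1 → EuclideanSpace ℝ (Fin 3)) (_ : ∀ θ, mfderiv (𝓡 3) (𝓡∂ 4) bX.incl (z θ) (u θ) = mfderiv (𝓡∂ 4) (𝓡∂ 4) (fun a : ↥(coresComplement h) => D.jA a) ⟨K θ, hK θ⟩ (ν θ)) (R : AmbientIsotopy (𝓡∂ 4) (Base g)) (_ : ∀ (t : ℝ) (x : Base g), rho g (R.toFun t x).1 = rho g x.1) (_ : ∀ (t : ℝ) (x : Base g), ∃ r : ℝ, 0 < r ∧ w g (R.toFun t x).1 = (r : ℂ) * w g x.1) (_ : ∀ θ, R.toFun 1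 ((bBase g).incl (Ψ (z θ))) ∈ page g c), pageTwisting g (R.toFun 1 ∘ fun θ => ((bBase g).incl (Ψ (z θ)) : Base g)) (fun θ => mfderiv (𝓡∂ 4) (𝓡∂ 4) (R.toFun 1) ((bBase g).incl (Ψ (z θ))) (mfderiv (𝓡 3) (𝓡∂ 4) (fun y => ((bBase g).incl (Ψ y) : Base g)) (z θ) (u θ))) = s₀ * pageTwisting g K ν)
    (Hgap : ∀ (g : ℕ) (P N : List ((Fin g ⊕ Fin g → ℤ) × Bool)) (h : Fin (P ++ N).length → HandleAttachingMap 3 2 (Base g)) (hlink : IsLefschetzLink g (P ++ N) h) {X : Type} [TopologicalSpace X] [T2Space X] [SecondCountableTopology X] [CompactSpace X] [ChartedSpace (EuclideanHalfSpace 4) X] [IsManifold (𝓡∂ 4) ∞ X] (D : MultiAttachmentData h (𝓡∂ 4) X) (bX : BoundaryData (𝓡∂ 4) X (𝓡 3)) (Ψ : bX.carrier ≃ₘ⟮𝓡 3, 𝓡 3⟯ (bBase g).carrier) (hpage : ∀ (y : bX.carrier) (a : ↥(coresComplement h)), bX.incl y = D.jA a → ∃ c : ℝ, 0 < c ∧ w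 g ((bBase g).incl (Ψ y)).1 = (c : ℂ) * w g (a : Base g).1) {X₁ : Type} [TopologicalSpace X₁] [T2Space X₁] [SecondCountableTopology X₁] [CompactSpace X₁] [ChartedSpace (EuclideanHalfSpace 4) X₁] [IsManifold (𝓡∂ 4) ∞ X₁] (D₁ : MultiAttachmentData (fun i : Fin P.length => h (Fin.cast List.length_append.symm (Fin.castAdd N.length i))) (𝓡∂ 4) X₁) {W₂ : Type} [TopologicalSpace W₂] [T2Space W₂] [SecondCountableTopology W₂] [CompactSpace W₂] [ChartedSpace (EuclideanHalfSpace 4) W₂] [IsManifold (𝓡∂ 4) ∞ W₂] (b₂ : BoundaryData (𝓡∂ 4) W₂ (𝓡 3)) (φ : (BoundaryManifold.boundaryData 3 X₁).carrier ≃ₘ⟮𝓡 3, 𝓡 3⟯ b₂.carrier) (col : (BoundaryManifold.boundaryData 3 (Base g)).Collar) (κ δ : ℝ) (hκ : 0 < κ) (hκ1 : κ ≤ 1) (hδ : 0 < δ) (hδ2 : δ ≤ 1 / 2) (D₂ : MultiAttachmentData (fun j : Fin N.length => dualMap D bX (bBase g) Ψ col κ δ hκ hκ1 hδ hδ2 (Fin.cast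 List.length_append.symm (Fin.natAdd P.length j))) (𝓡∂ 4) W₂) (hseam : ∀ (y : (BoundaryManifold.boundaryData 3 X₁).carrier) (a : ↥(coresComplement h)) (ha₁ : (a : Base g) ∈ coresComplement (fun i : Fin P.length => h (Fin.cast List.length_append.symm (Fin.castAdd N.length i)))) (z : bX.carrier) (hz : D.jA a = bX.incl z), (BoundaryManifold.boundaryData 3 X₁).incl y = D₁.jA ⟨a, ha₁⟩ → (∀ (j : Fin N.length) (t : ↥(handleTube 3 2)), (h (Fin.cast List.length_append.symm (Fin.natAdd P.length j))).toFun t = (a : Base g) → ‖lamPart ((t : closedBall (0 : EuclideanSpace ℝ (Fin 4)) 1) : EuclideanSpace ℝ (Fin 4))‖ ^ 2 ≤ 1 - 3 * κ ^ 2 / 4) → b₂.incl (φ y) = D₂.jA ⟨(bBase g).incl (Ψ z), incl_mem_coresComplement_dualMap D bX (bBase g) Ψ col κ δ hκ hκ1 hδ hδ2 (fun j : Fin N.length => Fin.cast List.length_append.symm (Fin.natAdd P.length j)) z a hz⟩) (s' : Bool) (h' : Fin N.length → HandleAttachingMap 3 2 (Base g)) (_ : ∀ j, ∃ c : ℂ,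 ‖c‖ = 1 ∧ ∀ θ, (h' j).attachingCircle θ ∈ page g c) (_ : ∀ j, shadow g (h' j).attachingCircle (h' j).continuous_attachingCircle ≠ 0) (_ : ∀ j, pageTwisting g (h' j).attachingCircle (h' j).attachingFraming = if s' then -1 else 1) (_ : Pairwise fun i j => Disjoint (range (h' i).toFun) (range (h' j).toFun)) (_ : HandleAttachingMap.IsMultiAttachment h' (𝓡∂ 4) W₂), ∃ (q₂ : Fin N.length → HandleAttachingMap 3 2 (Base g)) (D₂p : MultiAttachmentData q₂ (𝓡∂ 4) W₂) (s : Bool), (∀ j, ∃ c : ℂ, ‖c‖ = 1 ∧ ∀ θ, (q₂ j).attachingCircle θ ∈ page g c) ∧ (∀ j, shadow g (q₂ j).attachingCircle (q₂ j).continuous_attachingCircle ≠ 0) ∧ (∀ j, pageTwisting g (q₂ j).attachingCircle (q₂ j).attachingFraming = if s then -1 else 1) ∧ (∃ (y₀ : (BoundaryManifold.boundaryData 3 X₁).carrier) (a₁ : ↥(coresComplement (fun i : Fin P.length => h (Fin.cast List.length_append.symm (Fin.castAdd N.length i))))) (a₂ : ↥(coresComplement q₂)), (BoundaryManifold.boundaryData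 3 X₁).incl y₀ = D₁.jA a₁ ∧ b₂.incl (φ y₀) = D₂p.jA a₂ ∧ ∀ (uu : Fin 3 → EuclideanSpace ℝ (Fin 3)) (v₁ v₂ : Fin 3 → EuclideanSpace ℝ (Fin 4)), (∀ k, mfderiv (𝓡 3) (𝓡∂ 4) (BoundaryManifold.boundaryData 3 X₁).incl y₀ (uu k) = mfderiv (𝓡∂ 4) (𝓡∂ 4) D₁.jA a₁ (v₁ k)) → (∀ k, mfderiv (𝓡 3) (𝓡∂ 4) (b₂.incl ∘ φ) y₀ (uu k) = mfderiv (𝓡∂ 4) (𝓡∂ 4) D₂p.jA a₂ (v₂ k)) → IsPosBdryFrame (fun i : Fin P.length => h (Fin.cast List.length_append.symm (Fin.castAdd N.length i))) a₁ v₁ → 0 < (if s then (1 : ℝ) else -1) * det4 (gradient (rho g) (a₂ : Base g).1) (ambientC q₂ a₂ (v₂ 0)) (ambientC q₂ a₂ (v₂ 1)) (ambientC q₂ a₂ (v₂ 2))) ∧ (∀ ap : ↥(coresComplement q₂), ∃ (a' : ↥(coresComplement (fun j : Fin N.length => dualMap D bX (bBase g) Ψ col κ δ hκ hκ1 hδ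 hδ2 (Fin.cast List.length_append.symm (Fin.natAdd P.length j))))) (c : ℝ), 0 < c ∧ D₂p.jA ap = D₂.jA a' ∧ w g (ap : Base g).1 = (c : ℂ) * w g (a' : Base g).1) ∧ (∀ a' : ↥(coresComplement (fun j : Fin N.length => dualMap D bX (bBase g) Ψ col κ δ hκ hκ1 hδ hδ2 (Fin.cast List.length_append.symm (Fin.natAdd P.length j)))), ∃ ap : ↥(coresComplement q₂), D₂p.jA ap = D₂.jA a'))
    (Hsign : ∀ (g : ℕ) (ι₁ ι₂ : Type) [Finite ι₁] [Finite ι₂] (q₁ : ι₁ → Literature.Topology.FourManifolds.HandleAttachingMap 3 2 (Literature.Topology.FourManifolds.LefschetzBase.Base g)) (X₁ : Type) [TopologicalSpace X₁] [T2Space X₁] [ChartedSpace (EuclideanHalfSpace 4) X₁] [IsManifold (𝓡∂ 4) ∞ X₁] (D₁ : Literature.Topology.FourManifolds.HandleAttachingMap.MultiAttachmentData q₁ (𝓡∂ 4) X₁) (b₁ : Literature.Topology.FourManifolds.BoundaryData (𝓡∂ 4) X₁ (𝓡 3)) (W₂ : Type) [TopologicalSpace W₂] [T2Space W₂] [ChartedSpace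 (EuclideanHalfSpace 4) W₂] [IsManifold (𝓡∂ 4) ∞ W₂] (b₂ : Literature.Topology.FourManifolds.BoundaryData (𝓡∂ 4) W₂ (𝓡 3)) (φ : b₁.carrier ≃ₘ⟮𝓡 3, 𝓡 3⟯ b₂.carrier) (q₂ : ι₂ → Literature.Topology.FourManifolds.HandleAttachingMap 3 2 (Literature.Topology.FourManifolds.LefschetzBase.Base g)) (D₂ : Literature.Topology.FourManifolds.HandleAttachingMap.MultiAttachmentData q₂ (𝓡∂ 4) W₂) (s : Bool), (∀ j, ∃ c : ℂ, ‖c‖ = 1 ∧ ∀ θ, (q₂ j).attachingCircle θ ∈ Literature.Topology.FourManifolds.LefschetzBase.page g c) → (∀ j, Literature.Topology.FourManifolds.LefschetzBase.shadow g (q₂ j).attachingCircle (q₂ j).continuous_attachingCircle ≠ 0) → (∀ j, Literature.Topology.FourManifolds.LefschetzBase.pageTwisting g (q₂ j).attachingCircle (q₂ j).attachingFraming = if s then -1 else 1) → ∀ y₀ a₁ a₂, b₁.incl y₀ = D₁.jA a₁ → b₂.incl (φ y₀) = D₂.jA a₂ → (∀ (uu : Fin 3 → EuclideanSpace ℝ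 (Fin 3)) (v₁ v₂ : Fin 3 → EuclideanSpace ℝ (Fin 4)), (∀ k, mfderiv (𝓡 3) (𝓡∂ 4) b₁.incl y₀ (uu k) = mfderiv (𝓡∂ 4) (𝓡∂ 4) D₁.jA a₁ (v₁ k)) → (∀ k, mfderiv (𝓡 3) (𝓡∂ 4) (b₂.incl ∘ φ) y₀ (uu k) = mfderiv (𝓡∂ 4) (𝓡∂ 4) D₂.jA a₂ (v₂ k)) → Literature.Geometry.Symplectic.IsPosBdryFrame q₁ a₁ v₁ → 0 < (if s then (1 : ℝ) else -1) * Literature.Geometry.Symplectic.det4 (gradient (Literature.Topology.FourManifolds.LefschetzBase.rho g) a₂.1.1) (Literature.Geometry.Symplectic.ambientC q₂ a₂ (v₂ 0)) (Literature.Geometry.Symplectic.ambientC q₂ a₂ (v₂ 1)) (Literature.Geometry.Symplectic.ambientC q₂ a₂ (v₂ 2))) → ∃ (τ : Literature.Topology.FourManifolds.LefschetzBase.Base g ≃ₘ⟮𝓡∂ 4, 𝓡∂ 4⟯ Literature.Topology.FourManifolds.LefschetzBase.Base g) (h₂ : ι₂ → Literature.Topology.FourManifolds.HandleAttachingMap 3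 2 (Literature.Topology.FourManifolds.LefschetzBase.Base g)) (D₂'' : Literature.Topology.FourManifolds.HandleAttachingMap.MultiAttachmentData h₂ (𝓡∂ 4) W₂), (∀ x, Literature.Topology.FourManifolds.LefschetzBase.w g (τ x).1 = Literature.Topology.FourManifolds.LefschetzBase.w g x.1) ∧ (∀ x, Literature.Topology.FourManifolds.LefschetzBase.rho g (τ x).1 = Literature.Topology.FourManifolds.LefschetzBase.rho g x.1) ∧ (∀ x, τ (τ x) = x) ∧ (∀ j, h₂ j = (q₂ j).transport τ) ∧ (∀ (a : Literature.Topology.FourManifolds.HandleAttachingMap.coresComplement h₂) (a' : Literature.Topology.FourManifolds.HandleAttachingMap.coresComplement q₂), a'.1 = τ a.1 → D₂''.jA a = D₂.jA a') ∧ (∀ i b, D₂''.jB i b = D₂.jB i b) ∧ (∀ j, ∃ c : ℂ, ‖c‖ = 1 ∧ ∀ θ, (h₂ j).attachingCircle θ ∈ Literature.Topology.FourManifolds.LefschetzBase.page g c) ∧ (∀ j, Literature.Topology.FourManifolds.LefschetzBase.shadow g (h₂ j).attachingCircle (h₂ j).continuous_attachingCircle ≠ 0) ∧ (∀ j, Literature.Topology.FourManifolds.LefschetzBase.pageTwisting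 g (h₂ j).attachingCircle (h₂ j).attachingFraming = -1) ∧ (∃ (y : b₁.carrier) (a₁ : Literature.Topology.FourManifolds.HandleAttachingMap.coresComplement q₁) (a₂ : Literature.Topology.FourManifolds.HandleAttachingMap.coresComplement h₂) (uu : Fin 3 → EuclideanSpace ℝ (Fin 3)) (v₁ v₂ : Fin 3 → EuclideanSpace ℝ (Fin 4)), b₁.incl y = D₁.jA a₁ ∧ b₂.incl (φ y) = D₂''.jA a₂ ∧ (∀ k, mfderiv (𝓡 3) (𝓡∂ 4) b₁.incl y (uu k) = mfderiv (𝓡∂ 4) (𝓡∂ 4) D₁.jA a₁ (v₁ k)) ∧ (∀ k, mfderiv (𝓡 3) (𝓡∂ 4) (b₂.incl ∘ φ) y (uu k) = mfderiv (𝓡∂ 4) (𝓡∂ 4) D₂''.jA a₂ (v₂ k)) ∧ Literature.Geometry.Symplectic.IsPosBdryFrame q₁ a₁ v₁ ∧ Literature.Geometry.Symplectic.IsPosBdryFrame h₂ a₂ v₂))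
    (HF : ∀ {g : ℕ} {ι : Type} [Finite ι] {h : ι → HandleAttachingMap 3 2 (Base g)} {X : Type} [TopologicalSpace X] [ChartedSpace (EuclideanHalfSpace 4) X] [IsManifold (𝓡∂ 4) ∞ X] {bX : BoundaryData (𝓡∂ 4) X (𝓡 3)} [Nonempty bX.carrier] {ι₁ : Type} [Finite ι₁] {ι' : Type} [Finite ι'] {X₁ : Type} [TopologicalSpace X₁] [T2Space X₁] [CompactSpace X₁] [ChartedSpace (EuclideanHalfSpace 4) X₁] [IsManifold (𝓡∂ 4) ∞ X₁] {W₂ : Type} [TopologicalSpace W₂] [ChartedSpace (EuclideanHalfSpace 4) W₂] [IsManifold (𝓡∂ 4) ∞ W₂] (D : MultiAttachmentData h (𝓡∂ 4) X) (G : BoundaryGlueData bX (bBase g)) (e : ι₁ → ι) (f : ι' → ι) (hf : Injective f) (hef : ∀ i, i ∈ range e ∨ i ∈ range f) (hdisj : ∀ (j : ι') (i : ι₁), Disjoint (range (h (f j)).toFun) (range (h (e i)).toFun)) (D₁ : MultiAttachmentData (fun i => h (e i)) (𝓡∂ 4) X₁) (D₂' : MultiAttachmentData (fun j => D₁.lift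 (h (f j)) (hdisj j)) (𝓡∂ 4) X) (hA : ∀ (a : ↥(coresComplement h)) (ha₁ : (a : Base g) ∈ coresComplement fun i => h (e i)) (ha₂ : D₁.jA ⟨a, ha₁⟩ ∈ coresComplement fun j => D₁.lift (h (f j)) (hdisj j)), D₂'.jA ⟨D₁.jA ⟨a, ha₁⟩, ha₂⟩ = D.jA a) (hB : ∀ (i : ι₁) (b : ↥(beltPiece 3 2)) (hb : D₁.jB i b ∈ coresComplement fun j => D₁.lift (h (f j)) (hdisj j)), D₂'.jA ⟨D₁.jB i b, hb⟩ = D.jB (e i) b) (hC : ∀ (j : ι') (b : ↥(beltPiece 3 2)), D₂'.jB j b = D.jB (f j) b) {aC κ δ : ℝ} (ha : 0 < aC) (hκ : 0 < κ) (hκ2 : κ ≤ 1 / 2) (hκ1 : κ ≤ 1) (hδ : 0 < δ) (hδ2 : δ ≤ 1 / 2) (col : (BoundaryManifold.boundaryData 3 (Base g)).Collar) (hCM : ∀ j, CollarAdapted D (f j) G aC) (hcol : ∀ (w : (BoundaryManifold.boundaryData 3 (Base g)).carrier) (x : (bBase g).carrier), (BoundaryManifold.boundaryData 3 (Base g)).incl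 w = (bBase g).incl x → ∀ t : Set.Icc (0 : ℝ) 1, col.toFun (w, t) = G.CN.toFun x ((t : ℝ) / (2 - t))) {jX₁ : X₁ → G.d₂.Glued} (hYa : ∀ (p : X₁) (hp : p ∈ coresComplement fun j => D₁.lift (h (f j)) (hdisj j)), (∀ (j : ι') (y : ↥(handleTube 3 2)), (D₁.lift (h (f j)) (hdisj j)).toFun y = p → ‖lamPart ((y : closedBall (0 : EuclideanSpace ℝ (Fin 4)) 1) : EuclideanSpace ℝ (Fin 4))‖ ^ 2 ≤ 1 - 3 * κ ^ 2 / 4) → jX₁ p = G.jM (D₂'.jA ⟨p, hp⟩)) (hYb : ∀ (j : ι') (y : ↥(handleTube 3 2)) (b : ↥(beltPiece 3 2)), ((b : closedBall (0 : EuclideanSpace ℝ (Fin 4)) 1) : EuclideanSpace ℝ (Fin 4)) = handleInversion 2 (PushModel.selfPush κ δ ((y : closedBall (0 : EuclideanSpace ℝ (Fin 4)) 1) : EuclideanSpace ℝ (Fin 4))) → jX₁ ((D₁.lift (h (f j)) (hdisj j)).toFun y) = G.jM (D₂'.jB j b)) (b₂ : BoundaryData (𝓡∂ 4) W₂ (𝓡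 3)) {jW₂ : W₂ → G.d₂.Glued} (hjW₂ : Injective jW₂) (φ : (BoundaryManifold.boundaryData 3 X₁).carrier ≃ₘ⟮𝓡 3, 𝓡 3⟯ b₂.carrier) (hseamId : ∀ z, jW₂ (b₂.incl (φ z)) = jX₁ ((BoundaryManifold.boundaryData 3 X₁).incl z)) (D₂ : MultiAttachmentData (fun j : ι' => dualMap D bX (bBase g) G.φ col κ δ hκ hκ1 hδ hδ2 (f j)) (𝓡∂ 4) W₂) (hE1 : ∀ (w : Base g) (hw : w ∈ coresComplement fun j : ι' => dualMap D bX (bBase g) G.φ col κ δ hκ hκ1 hδ hδ2 (f j)), (∀ (j : ι') (y : ↥(handleTube 3 2)), (dualMap D bX (bBase g) G.φ col κ δ hκ hκ1 hδ hδ2 (f j)).toFun y ≠ w) → jW₂ (D₂.jA ⟨w, hw⟩) = G.jN w) (hF1 : ∀ (j : ι') (zb b : ↥(beltPiece 3 2)), ((b : closedBall (0 : EuclideanSpace ℝ (Fin 4)) 1) : EuclideanSpace ℝ (Fin 4)) = modelF aC κ δ ((zb : closedBall (0 : EuclideanSpace ℝ (Fin 4)) 1) : EuclideanSpace ℝ (Fin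 4)) → jW₂ (D₂.jB j zb) = G.jM (D.jB (f j) b)) (hpage : ∀ (y : bX.carrier) (a : ↥(coresComplement h)), bX.incl y = D.jA a → ∃ c : ℝ, 0 < c ∧ w g ((bBase g).incl (G.φ y)).1 = (c : ℂ) * w g (a : Base g).1) (hbelt : ∀ (y : bX.carrier) (k : ι) (b : ↥(beltPiece 3 2)), bX.incl y = D.jB k b → bX.incl y ∉ range D.jA → w g ((bBase g).incl (G.φ y)).1 ≠ 0), ∃ F : (BoundaryManifold.boundaryData 3 X₁).carrier → ℂ, ContMDiff (𝓡 3) 𝓘(ℝ, ℂ) ∞ F ∧ (∀ (y : (BoundaryManifold.boundaryData 3 X₁).carrier) (a : ↥(coresComplement fun i => h (e i))), (BoundaryManifold.boundaryData 3 X₁).incl y = D₁.jA a → ∃ c : ℝ, 0 < c ∧ F y = c * w g (a : Base g).1) ∧ (∀ (y : (BoundaryManifold.boundaryData 3 X₁).carrier) (a' : ↥(coresComplement fun j : ι' => dualMap D bX (bBase g) G.φ col κ δ hκ hκ1 hδ hδ2 (f j))), b₂.incl (φ y) = D₂.jA a' → ∃ c : ℝ, 0 < c ∧ F y = c * w g (a'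 : Base g).1) ∧ (∀ y, F y = 0 → ∃ a : ↥(coresComplement fun i => h (e i)), (BoundaryManifold.boundaryData 3 X₁).incl y = D₁.jA a) ∧ (∀ y, F y ≠ 0 → ∃ v : EuclideanSpace ℝ (Fin 3), ((starRingEnd ℂ) (F y) * @id ℂ (mfderiv (𝓡 3) 𝓘(ℝ, ℂ) F y v)).im ≠ 0))
    (Hbind : ∀ (g : ℕ) (P N : List ((Fin g ⊕ Fin g → ℤ) × Bool)) (h : Fin (P ++ N).length → HandleAttachingMap 3 2 (Base g)) (hlink : IsLefschetzLink g (P ++ N) h), ∃ κ₀ : ℝ, 0 < κ₀ ∧ ∀ {X : Type} [TopologicalSpace X] [T2Space X] [SecondCountableTopology X] [CompactSpace X] [ChartedSpace (EuclideanHalfSpace 4) X] [IsManifold (𝓡∂ 4) ∞ X] (D : MultiAttachmentData h (𝓡∂ 4) X) (bX : BoundaryData (𝓡∂ 4) X (𝓡 3)) (Ψ : bX.carrier ≃ₘ⟮𝓡 3, 𝓡 3⟯ (bBase g).carrier) (hpage : ∀ (y : bX.carrier) (a : ↥(coresComplement h)), bX.incl y = D.jA a → ∃ c : ℝ, 0 <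 c ∧ w g ((bBase g).incl (Ψ y)).1 = (c : ℂ) * w g (a : Base g).1) {X₁ : Type} [TopologicalSpace X₁] [T2Space X₁] [SecondCountableTopology X₁] [CompactSpace X₁] [ChartedSpace (EuclideanHalfSpace 4) X₁] [IsManifold (𝓡∂ 4) ∞ X₁] (D₁ : MultiAttachmentData (fun i : Fin P.length => h (Fin.cast List.length_append.symm (Fin.castAdd N.length i))) (𝓡∂ 4) X₁) {W₂ : Type} [TopologicalSpace W₂] [T2Space W₂] [SecondCountableTopology W₂] [CompactSpace W₂] [ChartedSpace (EuclideanHalfSpace 4) W₂] [IsManifold (𝓡∂ 4) ∞ W₂] (b₂ : BoundaryData (𝓡∂ 4) W₂ (𝓡 3)) (φ : (BoundaryManifold.boundaryData 3 X₁).carrier ≃ₘ⟮𝓡 3, 𝓡 3⟯ b₂.carrier) (col : (BoundaryManifold.boundaryData 3 (Base g)).Collar) (κ δ : ℝ) (hκ : 0 < κ) (hκ1 : κ ≤ 1) (hδ : 0 < δ) (hδ2 : δ ≤ 1 / 2) (hκ0 : κ ≤ κ₀) (D₂ : MultiAttachmentData (fun j : Fin N.length => dualMap D bX (bBase g) Ψ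 col κ δ hκ hκ1 hδ hδ2 (Fin.cast List.length_append.symm (Fin.natAdd P.length j))) (𝓡∂ 4) W₂) (hseam : ∀ (y : (BoundaryManifold.boundaryData 3 X₁).carrier) (a : ↥(coresComplement h)) (ha₁ : (a : Base g) ∈ coresComplement (fun i : Fin P.length => h (Fin.cast List.length_append.symm (Fin.castAdd N.length i)))) (z : bX.carrier) (hz : D.jA a = bX.incl z), (BoundaryManifold.boundaryData 3 X₁).incl y = D₁.jA ⟨a, ha₁⟩ → (∀ (j : Fin N.length) (t : ↥(handleTube 3 2)), (h (Fin.cast List.length_append.symm (Fin.natAdd P.length j))).toFun t = (a : Base g) → ‖lamPart ((t : closedBall (0 : EuclideanSpace ℝ (Fin 4)) 1) : EuclideanSpace ℝ (Fin 4))‖ ^ 2 ≤ 1 - 3 * κ ^ 2 / 4) → b₂.incl (φ y) = D₂.jA ⟨(bBase g).incl (Ψ z), incl_mem_coresComplement_dualMap D bX (bBase g) Ψ col κ δ hκ hκ1 hδ hδ2 (fun j : Fin N.length => Fin.cast List.length_append.symm (Fin.natAdd P.length j)) z a hz⟩), ∀ (y : (BoundaryManifold.boundaryData 3 X₁).carrier)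 (a : ↥(coresComplement (fun i : Fin P.length => h (Fin.cast List.length_append.symm (Fin.castAdd N.length i))))), (BoundaryManifold.boundaryData 3 X₁).incl y = D₁.jA a → w g (a : Base g).1 = 0 → ∃ a' : ↥(coresComplement (fun j : Fin N.length => dualMap D bX (bBase g) Ψ col κ δ hκ hκ1 hδ hδ2 (Fin.cast List.length_append.symm (Fin.natAdd P.length j)))), b₂.incl (φ y) = D₂.jA a')
    (Hconn : ∀ (g : ℕ) {ι : Type} [Finite ι] (h : ι → Literature.Topology.FourManifolds.HandleAttachingMap 3 2 (Literature.Topology.FourManifolds.LefschetzBase.Base g)) (X₁ : Type) [TopologicalSpace X₁] [ChartedSpace (EuclideanHalfSpace 4) X₁] (D₁ : Literature.Topology.FourManifolds.HandleAttachingMap.MultiAttachmentData h (𝓡∂ 4) X₁) (b₁ : Literature.Topology.FourManifolds.BoundaryData (𝓡∂ 4) X₁ (𝓡 3)), ConnectedSpace b₁.carrier) :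
    ∀ (M : Type) [TopologicalSpace M] [T2Space M] [SecondCountableTopology M] [ChartedSpace (EuclideanSpace ℝ (Fin 4)) M] [IsManifold (𝓡 4) ∞ M] (g : ℕ) (P N : List ((Fin g ⊕ Fin g → ℤ) × Bool)), Literature.Topology.FourManifolds.LefschetzBase.ModelsOnFibred M g (P ++ N) → (∀ x ∈ N, x.2 = false) → (∀ x ∈ P ++ N, x.1 ≠ 0) → ∃ (h : Fin (P ++ N).length → Literature.Topology.FourManifolds.HandleAttachingMap 3 2 (Literature.Topology.FourManifolds.LefschetzBase.Base g)) (X₁ : Type) (_ : TopologicalSpace X₁) (_ : T2Space X₁) (_ : SecondCountableTopology X₁) (_ : CompactSpace X₁) (_ : ChartedSpace (EuclideanHalfSpace 4) X₁) (_ : IsManifold (𝓡∂ 4) ∞ X₁) (D₁ : Literature.Topology.FourManifolds.HandleAttachingMap.MultiAttachmentData (fun i : Fin P.length => h (Fin.cast List.length_append.symm (Fin.castAdd N.length i))) (𝓡∂ 4) X₁) (W₂ : Type) (_ : TopologicalSpace W₂) (_ : ChartedSpace (EuclideanHalfSpace 4) W₂) (_ : IsManifold (𝓡∂ 4) ∞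 W₂) (_ : CompactSpace W₂) (_ : T2Space W₂) (_ : SecondCountableTopology W₂) (b₁ : Literature.Topology.FourManifolds.BoundaryData (𝓡∂ 4) X₁ (𝓡 3)) (b₂ : Literature.Topology.FourManifolds.BoundaryData (𝓡∂ 4) W₂ (𝓡 3)) (φ : b₁.carrier ≃ₘ⟮𝓡 3, 𝓡 3⟯ b₂.carrier) (h₂ : Fin N.length → Literature.Topology.FourManifolds.HandleAttachingMap 3 2 (Literature.Topology.FourManifolds.LefschetzBase.Base g)) (D₂ : Literature.Topology.FourManifolds.HandleAttachingMap.MultiAttachmentData h₂ (𝓡∂ 4) W₂) (F : b₁.carrier → ℂ), Literature.Topology.FourManifolds.LefschetzBase.IsLefschetzLink g (P ++ N) h ∧ Literature.Topology.FourManifolds.IsBoundaryGluing b₁ b₂ φ (𝓡 4) M ∧ (∀ j, ∃ c : ℂ, ‖c‖ = 1 ∧ ∀ θ, (h₂ j).attachingCircle θ ∈ Literature.Topology.FourManifolds.LefschetzBase.page g c) ∧ (∀ j, Literature.Topology.FourManifolds.LefschetzBase.shadow g (h₂ j).attachingCircle (h₂ j).continuous_attachingCircle ≠ 0) ∧ (∀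 j, Literature.Topology.FourManifolds.LefschetzBase.pageTwisting g (h₂ j).attachingCircle (h₂ j).attachingFraming = -1) ∧ ContMDiff (𝓡 3) 𝓘(ℝ, ℂ) ∞ F ∧ (∀ y a, b₁.incl y = D₁.jA a → ∃ c : ℝ, 0 < c ∧ F y = c * Literature.Topology.FourManifolds.LefschetzBase.w g a.1.1) ∧ (∀ y a', b₂.incl (φ y) = D₂.jA a' → ∃ c : ℝ, 0 < c ∧ F y = c * Literature.Topology.FourManifolds.LefschetzBase.w g a'.1.1) ∧ (∀ y, F y = 0 → ∃ a, b₁.incl y = D₁.jA a) ∧ (∀ y, F y ≠ 0 → ∃ v : EuclideanSpace ℝ (Fin 3), ((starRingEnd ℂ) (F y) * @id ℂ (mfderiv (𝓡 3) 𝓘(ℝ, ℂ) F y v)).im ≠ 0) ∧ (∀ y a, b₁.incl y = D₁.jA a → Literature.Topology.FourManifolds.LefschetzBase.w g a.1.1 = 0 → ∃ a', b₂.incl (φ y) = D₂.jA a') ∧ (∃ (y : b₁.carrier) (a₁ : Literature.Topology.FourManifolds.HandleAttachingMap.coresComplement (fun i : Fin P.length => h (Fin.cast List.length_append.symm (Fin.castAdd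 N.length i)))) (a₂ : Literature.Topology.FourManifolds.HandleAttachingMap.coresComplement h₂) (uu : Fin 3 → EuclideanSpace ℝ (Fin 3)) (v₁ v₂ : Fin 3 → EuclideanSpace ℝ (Fin 4)), b₁.incl y = D₁.jA a₁ ∧ b₂.incl (φ y) = D₂.jA a₂ ∧ (∀ k, mfderiv (𝓡 3) (𝓡∂ 4) b₁.incl y (uu k) = mfderiv (𝓡∂ 4) (𝓡∂ 4) D₁.jA a₁ (v₁ k)) ∧ (∀ k, mfderiv (𝓡 3) (𝓡∂ 4) (b₂.incl ∘ φ) y (uu k) = mfderiv (𝓡∂ 4) (𝓡∂ 4) D₂.jA a₂ (v₂ k)) ∧ Literature.Geometry.Symplectic.IsPosBdryFrame (fun i : Fin P.length => h (Fin.cast List.length_append.symm (Fin.castAdd N.length i))) a₁ v₁ ∧ Literature.Geometry.Symplectic.IsPosBdryFrame h₂ a₂ v₂) ∧ ConnectedSpace b₁.carrier := by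
  intro M _ _ _ _ _ g P N hM hNs hnz
  obtain ⟨X, _, _, _, _, _, _, h, D, bX, Ψ, hlink, hglue, hpage⟩ := hM
  have hN0 : ∀ x ∈ N, x.1 ≠ 0 := fun x hx => hnz x (List.mem_append_right P hx)
  -- X6's constant `κ₀` (binding points have shallow suffix-tube preimages for `κ ≤ κ₀`)
  obtain ⟨κ₀, hκ₀, Hbind'⟩ := Hbind g P N h hlink
  -- V5: the compatible split `X₁ = Base g ∪ (prefix)`, suffix data `D₂'` on `X`
  obtain ⟨X₁, _, _, _, _, _, _, D₁, D₂', hA, hB, hC⟩ :=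
    exists_compatible_split P.length N.length (List.length_append (as := P) (bs := N)) h D
  -- V5: the standard form of the gluing around the suffix belt circles; `Ψ := G.φ`
  haveI : Nonempty bX.carrier := by
    obtain ⟨y₀⟩ := nonempty_bBase_carrier g
    exact ⟨Ψ.symm y₀⟩
  have hsi := suffix_injective (List.length_append (as := P) (bs := N))
  obtain ⟨G, aC, col, hφ, ha, ⟨e⟩, hCM, hcol⟩ :=
    exists_standardForm D (fun j : Fin N.length => Fin.cast List.length_append.symm (Fin.natAdd P.length j)) hsi
      bX (bBase g) Ψ hglue
  subst hφ
  -- the constants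
  obtain ⟨κ, hκ, hκ2, hκ0⟩ : ∃ κ : ℝ, 0 < κ ∧ κ ≤ 1 / 2 ∧ κ ≤ κ₀ :=
    ⟨min (1 / 2) κ₀, lt_min (by norm_num) hκ₀, min_le_left _ _, min_le_right _ _⟩
  have hκ1 : κ ≤ 1 := hκ2.trans (by norm_num)
  obtain ⟨δ, hδ, hδ2, haδ⟩ : ∃ δ : ℝ, 0 < δ ∧ δ ≤ 1 / 2 ∧ aC * δ ≤ 1 / 5 := by
    refine ⟨min (1 / 2) (1 / (5 * aC)), lt_min (by norm_num) (by positivity), min_le_left _ _, ?_⟩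
    calc aC * min (1 / 2) (1 / (5 * aC)) ≤ aC * (1 / (5 * aC)) :=
          mul_le_mul_of_nonneg_left (min_le_right _ _) ha.le
      _ = 1 / 5 := by field_simp
  -- Y5: the pushed prefix embedding
  obtain ⟨jX₁, hemb, hrng, hYa, hYb, hYc, hYc'⟩ :=
    exists_pushedPrefixEmbedding D₂' G.isSmoothEmbedding_jM hκ hκ2 hδ hδ2
  have H2 : ∀ y : X, (∀ (j : Fin N.length) (b : ↥(beltPiece 3 2)),
      D.jB (Fin.cast List.length_append.symm (Fin.natAdd P.length j)) b ≠ y) → G.jM y ∈ range jX₁ :=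
    fun y hy => jM_mem_range_of_forall_ne D
      (fun j : Fin N.length => Fin.cast List.length_append.symm (Fin.natAdd P.length j)) D₂' hC G.jM hYc' hy
  have H3 : ∀ (j : Fin N.length) (b : ↥(beltPiece 3 2)),
      G.jM (D.jB (Fin.cast List.length_append.symm (Fin.natAdd P.length j)) b) ∈ range jX₁ ↔
        0 < ‖lamPart ((b : closedBall (0 : EuclideanSpace ℝ (Fin 4)) 1) : EuclideanSpace ℝ (Fin 4))‖ ^ 2 ∧
          0 ≤ modelH κ δ ((b : closedBall (0 : EuclideanSpace ℝ (Fin 4)) 1) : EuclideanSpace ℝ (Fin 4)) :=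
    fun j b => by rw [← hC]; exact hYc j b
  -- Y6: the complement piece `W₂ = {Φ ≤ 0}` on the concrete regular sublevel set
  have hΦ := isRegularLevel_levelFn D (fun j : Fin N.length => Fin.cast List.length_append.symm (Fin.natAdd P.length j))
    G ha hsi hCM hκ hκ2 hδ hδ2
  obtain ⟨φ, hglue', hseamId, -, -, -, -, -⟩ :=
    exists_complementPiece_concrete D (fun j : Fin N.length => Fin.cast List.length_append.symm (Fin.natAdd P.length j))
      G ha hsi hCM hκ hκ2 hδ hδ2 hΦ hemb hrng H2 H3
  have hglueM := isBoundaryGluing_of_diffeomorph hglue' e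
  -- X1: the dual data on `W₂`
  obtain ⟨D₂, hE1s, hE2⟩ := Hiv D (fun j : Fin N.length => Fin.cast List.length_append.symm (Fin.natAdd P.length j))
    G col ha hsi hCM hκ hκ2 hκ1 hδ hδ2 haδ hcol hΦ
  -- (E1) in the closed form (X1 exports the strict one)
  have hE1 : ∀ w : ↥(coresComplement fun j : Fin N.length =>
      dualMap D bX (bBase g) G.φ col κ δ hκ hκ1 hδ hδ2 (Fin.cast List.length_append.symm (Fin.natAdd P.length j))),
      (∀ (j : Fin N.length) (y : ↥(handleTube 3 2)),
        (dualMap D bX (bBase g) G.φ col κ δ hκ hκ1 hδ hδ2 (Fin.cast List.length_append.symm (Fin.natAdd P.length j))).toFun y =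
          (w : Base g) → lamSq 2 ((y : closedBall (0 : EuclideanSpace ℝ (Fin 4)) 1) : EuclideanSpace ℝ (Fin 4)) ≤ 1 / 4) →
      RegularSublevel.incl hΦ (D₂.jA w) = G.jN w :=
    apply_eq_of_forall_lamSq_le _ D₂.disjoint (fun w => RegularSublevel.incl hΦ (D₂.jA w))
      ((RegularSublevel.isSmoothEmbedding_incl hΦ).isEmbedding.continuous.comp D₂.hjA.isEmbedding.continuous) G.jN
      G.isSmoothEmbedding_jN.isEmbedding.continuous hE1s
  -- THE SEAM CLAUSE (shallow form)
  have hseam := fun (y : (BoundaryManifold.boundaryData 3 X₁).carrier) (a : ↥(coresComplement h))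
      (ha₁ : (a : Base g) ∈ coresComplement
        fun i : Fin P.length => h (Fin.cast List.length_append.symm (Fin.castAdd N.length i)))
      (z : bX.carrier) (hz : D.jA a = bX.incl z)
      (hy : (BoundaryManifold.boundaryData 3 X₁).incl y = D₁.jA ⟨a, ha₁⟩)
      (hsh : ∀ (j : Fin N.length) (t : ↥(handleTube 3 2)),
        (h (Fin.cast List.length_append.symm (Fin.natAdd P.length j))).toFun t = (a : Base g) →
        ‖lamPart ((t : closedBall (0 : EuclideanSpace ℝ (Fin 4)) 1) : EuclideanSpace ℝ (Fin 4))‖ ^ 2 ≤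
          1 - 3 * κ ^ 2 / 4) =>
    seam_clause_shallow P.length N.length (List.length_append (as := P) (bs := N)) D D₁ D₂' hA G col κ δ hκ hκ1
      hδ hδ2 jX₁ hYa (RegularSublevel.boundaryData hΦ) (RegularSublevel.incl hΦ) (RegularSublevel.injective_incl hΦ)
      φ hseamId D₂ hE1 y a ha₁ z hz hy hsh
  -- T3c-3 (Z7) from T3c-1′ (Y1) and T3c-2 (Y3) with ST4 (X3)
  obtain ⟨s', h', hp', hsh', htw', hdj', htr'⟩ :=
    node_dualLink_pageLink_of_universal_nodes
      (fun g l h hlink X _ _ _ _ _ _ D η hη hηπ => helper_belt_isotopic_pushoff g l h hlink D η hη hηπ)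
      (fun g l h hlink X _ _ _ _ _ _ D bX Ψ hpage =>
        node_seam_transport_of_twistSign D bX Ψ hlink hpage (HST4 g l h hlink D bX Ψ hpage))
      g P N h hlink D bX G.φ hpage col κ δ hκ hκ1 hδ hδ2 hN0 hNs
  have hmult' := htr' (RegularSublevel hΦ) D₂.isMultiAttachment
  -- the page presentation WITH DATA (unassigned node)
  obtain ⟨q₂, D₂p, s, hq₂p, hq₂s, hq₂t, ⟨y₀, a₁, a₂, hy₀, hy₀', Hχ⟩, R1p, R2p⟩ :=
    Hgap g P N h hlink D bX G.φ hpage D₁ (RegularSublevel.boundaryData hΦ) φ col κ δ hκ hκ1 hδ hδ2 D₂ hseam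
      s' h' hp' hsh' htw' hdj' hmult'
  -- X4: the sign pin and the ORSEAM frame
  obtain ⟨τ, h₂, D₂'', hτw, -, hττ, hh₂, hjA'', -, hpage₂, hshadow₂, htwist₂, horseam⟩ :=
    Hsign g (Fin P.length) (Fin N.length)
      (fun i : Fin P.length => h (Fin.cast List.length_append.symm (Fin.castAdd N.length i))) X₁ D₁
      (BoundaryManifold.boundaryData 3 X₁) (RegularSublevel hΦ) (RegularSublevel.boundaryData hΦ) φ q₂ D₂p s
      hq₂p hq₂s hq₂t y₀ a₁ a₂ hy₀ hy₀' Hχ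
  obtain ⟨hτ₁, hτ₂⟩ := mem_coresComplement_of_transport_invol τ hττ hh₂
  -- the bridges from `D₂''` to the dual data `D₂`
  have R1 : ∀ a'' : ↥(coresComplement h₂), ∃ (a' : ↥(coresComplement fun j : Fin N.length =>
      dualMap D bX (bBase g) G.φ col κ δ hκ hκ1 hδ hδ2 (Fin.cast List.length_append.symm (Fin.natAdd P.length j))))
      (c : ℝ), 0 < c ∧ D₂''.jA a'' = D₂.jA a' ∧ w g (a'' : Base g).1 = (c : ℂ) * w g (a' : Base g).1 := by
    intro a''
    obtain ⟨a', c, hc, hpa, hwa⟩ := R1p ⟨τ a'', hτ₁ a''⟩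
    have hja : D₂''.jA a'' = D₂p.jA ⟨τ a'', hτ₁ a''⟩ := hjA'' a'' ⟨τ a'', hτ₁ a''⟩ rfl
    have hw'' : w g (a'' : Base g).1 = w g (τ (a'' : Base g)).1 := (hτw (a'' : Base g)).symm
    exact ⟨a', c, hc, hja.trans hpa, hw''.trans hwa⟩
  have R2 : ∀ a' : ↥(coresComplement fun j : Fin N.length =>
      dualMap D bX (bBase g) G.φ col κ δ hκ hκ1 hδ hδ2 (Fin.cast List.length_append.symm (Fin.natAdd P.length j))),
      ∃ a'' : ↥(coresComplement h₂), D₂''.jA a'' = D₂.jA a' := by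
    intro a'
    obtain ⟨ap, hap⟩ := R2p a'
    have hmem : (τ ap : Base g) ∈ coresComplement h₂ := hτ₂ ap
    have hrel : (ap : Base g) = τ ((⟨τ ap, hmem⟩ : ↥(coresComplement h₂)) : Base g) := by
      rw [hττ]
    exact ⟨⟨τ ap, hmem⟩, (hjA'' ⟨τ ap, hmem⟩ ap hrel).trans hap⟩
  -- X5: the seam page function (its extra hypotheses: joint surjectivity of the index maps, (E1) off the
  -- dual ranges, (F1) in the handle chart through X1's (E2) and `gluedHandleChart_coe`, V4's belt clause)
  have hef := mem_range_prefix_or_suffix P N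
  have hE1' : ∀ (w : Base g) (hw : w ∈ coresComplement fun j : Fin N.length =>
      dualMap D bX (bBase g) G.φ col κ δ hκ hκ1 hδ hδ2 (Fin.cast List.length_append.symm (Fin.natAdd P.length j))),
      (∀ (j : Fin N.length) (y : ↥(handleTube 3 2)),
        (dualMap D bX (bBase g) G.φ col κ δ hκ hκ1 hδ hδ2 (Fin.cast List.length_append.symm (Fin.natAdd P.length j))).toFun y ≠ w) →
      RegularSublevel.incl hΦ (D₂.jA ⟨w, hw⟩) = G.jN w :=
    fun w hw hne => hE1 ⟨w, hw⟩ fun j y hy => absurd hy (hne j y)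
  have hF1 : ∀ (j : Fin N.length) (zb b : ↥(beltPiece 3 2)),
      ((b : closedBall (0 : EuclideanSpace ℝ (Fin 4)) 1) : EuclideanSpace ℝ (Fin 4)) =
        modelF aC κ δ ((zb : closedBall (0 : EuclideanSpace ℝ (Fin 4)) 1) : EuclideanSpace ℝ (Fin 4)) →
      RegularSublevel.incl hΦ (D₂.jB j zb) = G.jM (D.jB (Fin.cast List.length_append.symm (Fin.natAdd P.length j)) b) := by
    intro j zb b hb
    have hmem := (modelF_mem_chartDom ha hκ hκ2 hδ hδ2 haδ (belt_coe_mem zb).1 (belt_coe_mem zb).2).2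
    rw [← hb] at hmem
    rw [hE2 j zb, ← hb]
    exact gluedHandleChart_coe D _ G ha (hCM j) b hmem
  have hbelt : ∀ (y : bX.carrier) (k : Fin (P ++ N).length) (b : ↥(beltPiece 3 2)), bX.incl y = D.jB k b →
      bX.incl y ∉ range D.jA → w g ((bBase g).incl (G.φ y)).1 ≠ 0 := by
    intro y k b hyb hyr
    obtain ⟨c, hc, hw⟩ := helper_belt_pageClause g (P ++ N) X h D bX G.φ hlink hpage y k b hyb hyr
    rw [hw]
    refine mul_ne_zero (by exact_mod_cast hc.ne') fun h0 => ?_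
    have h1 := norm_pageDir (P ++ N).length k
    rw [h0, norm_zero] at h1
    exact zero_ne_one h1
  obtain ⟨F, hFs, hF₁, hF₂, hF0, hFd⟩ :=
    HF D G (fun i : Fin P.length => Fin.cast List.length_append.symm (Fin.castAdd N.length i))
      (fun j : Fin N.length => Fin.cast List.length_append.symm (Fin.natAdd P.length j)) hsi hef
      (disjoint_range_natAdd_castAdd (List.length_append (as := P) (bs := N)) D) D₁ D₂' hA hB hC ha hκ hκ2 hκ1
      hδ hδ2 col hCM hcol hYa hYb (RegularSublevel.boundaryData hΦ) (RegularSublevel.injective_incl hΦ) φ hseamId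
      D₂ hE1' hF1 hpage hbelt
  -- X6: connectedness of the seam
  have hconn := Hconn g (fun i : Fin P.length => h (Fin.cast List.length_append.symm (Fin.castAdd N.length i)))
    X₁ D₁ (BoundaryManifold.boundaryData 3 X₁)
  refine ⟨h, X₁, inferInstance, inferInstance, inferInstance, inferInstance, inferInstance, inferInstance, D₁,
    RegularSublevel hΦ, inferInstance, inferInstance, inferInstance, inferInstance, inferInstance, inferInstance,
    BoundaryManifold.boundaryData 3 X₁, RegularSublevel.boundaryData hΦ, φ, h₂, D₂'', F, hlink, hglueM, hpage₂,
    hshadow₂, htwist₂, hFs, hF₁, ?_, hF0, hFd, ?_, horseam, hconn⟩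
  · -- (ii-c) for `D₂''` through (R1)
    intro y a'' hy
    obtain ⟨a', c, hc, hja, hwa⟩ := R1 a''
    obtain ⟨c₁, hc₁, hF⟩ := hF₂ y a' (hy.trans hja)
    refine ⟨c₁ / c, div_pos hc₁ hc, ?_⟩
    have hc0 : (c : ℂ) ≠ 0 := by exact_mod_cast hc.ne'
    rw [hF, hwa, ← mul_assoc]
    congr 1
    push_cast
    rw [div_mul_cancel₀ _ hc0]
  · -- (iii) for `D₂''` through (R2)
    intro y a hy hw
    obtain ⟨a', ha'⟩ := Hbind' D bX G.φ hpage D₁ (RegularSublevel.boundaryData hΦ) φ col κ δ hκ hκ1 hδ hδ2 hκ0 D₂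
      hseam y a hy hw
    obtain ⟨a'', ha''⟩ := R2 a'
    exact ⟨a'', ha'.trans ha''.symm⟩

/-! ### §3 The contract with the LANDED bricks of X4 and X6 plugged in -/

/-- **T3 from FOUR statements**: `T3_of_pieces` with X4's landed sign pin
`helper_dualPresentation_signPin` and X6's landed `T3_bind`, `helper_T3_connected` plugged in; the
remaining inputs are X1's dual data (`Hiv`, landed as `helper_exists_dualAttachmentData` in
`…DualDataRecord.lean`), X3's ST4 (`HST4`), the unassigned node (`Hgap`) and X5's seam page function
(`HF`, `exists_seamPageFunction`). [cite: Baykur2006, Thm. 5.1 (proof, pp. 13–14)] -/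
theorem T3_of_four_pieces
    (Hiv : ∀ {B : Type} [TopologicalSpace B] [T2Space B] [ChartedSpace (EuclideanHalfSpace 4) B] {ι : Type} [Finite ι] {h : ι → Literature.Topology.FourManifolds.HandleAttachingMap 3 2 B} {X : Type} [TopologicalSpace X] [ChartedSpace (EuclideanHalfSpace 4) X] [IsManifold (𝓡∂ 4) ∞ X] (D : Literature.Topology.FourManifolds.HandleAttachingMap.MultiAttachmentData h (𝓡∂ 4) X) {ι' : Type} [Finite ι'] (f : ι' → ι) {bX : Literature.Topology.FourManifolds.BoundaryData (𝓡∂ 4) X (𝓡 3)} {W : Type} [TopologicalSpace W] [ChartedSpace (EuclideanHalfSpace 4) W] [IsManifold (𝓡∂ 4) ∞ W] {bW : Literature.Topology.FourManifolds.BoundaryData (𝓡∂ 4) W (𝓡 3)} [Nonempty bX.carrier] (G : Literature.Topology.FourManifolds.BoundaryGlueData bX bW) {a κ δ : ℝ} [CompactSpace X] [T2Space X] [T2Space W] [CompactSpace W] (col : (Literature.Topology.FourManifolds.BoundaryManifold.boundaryData 3 W).Collar) (ha : 0 < a) (hf : Function.Injective f) (hCM : ∀ j, Summit.SmoothPoincare4.SmoothPoincare4.Theorems.AcyclicBisectionExists.ModpBraidOrbits.CollarAdapted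 D (f j) G a) (hκ : 0 < κ) (hκ2 : κ ≤ 1 / 2) (hκ1 : κ ≤ 1) (hδ : 0 < δ) (hδ2 : δ ≤ 1 / 2), a * δ ≤ 1 / 5 → (∀ (w : (Literature.Topology.FourManifolds.BoundaryManifold.boundaryData 3 W).carrier) (x : bW.carrier), (Literature.Topology.FourManifolds.BoundaryManifold.boundaryData 3 W).incl w = bW.incl x → ∀ t : Set.Icc (0 : ℝ) 1, col.toFun (w, t) = G.CN.toFun x ((t : ℝ) / (2 - t))) → ∀ (hΦ : Literature.Topology.FourManifolds.IsRegularLevel (𝓡 4) (Summit.SmoothPoincare4.SmoothPoincare4.Theorems.AcyclicBisectionExists.ModpBraidOrbits.levelFn D f G a κ δ) 0), ∃ D₂ : Literature.Topology.FourManifolds.HandleAttachingMap.MultiAttachmentData (fun j : ι' => Summit.SmoothPoincare4.SmoothPoincare4.Theorems.AcyclicBisectionExists.ModpBraidOrbits.dualMap D bX bW G.φ col κ δ hκ hκ1 hδ hδ2 (f j)) (𝓡∂ 4) (Literature.Topology.FourManifolds.RegularSublevel hΦ), (∀ w : ↥(Literature.Topology.FourManifolds.HandleAttachingMap.coresComplement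 (fun j : ι' => Summit.SmoothPoincare4.SmoothPoincare4.Theorems.AcyclicBisectionExists.ModpBraidOrbits.dualMap D bX bW G.φ col κ δ hκ hκ1 hδ hδ2 (f j))), (∀ (j : ι') (y : ↥(Literature.Topology.FourManifolds.handleTube 3 2)), (Summit.SmoothPoincare4.SmoothPoincare4.Theorems.AcyclicBisectionExists.ModpBraidOrbits.dualMap D bX bW G.φ col κ δ hκ hκ1 hδ hδ2 (f j)).toFun y = (w : W) → Literature.Topology.FourManifolds.lamSq 2 ((y : Metric.closedBall (0 : EuclideanSpace ℝ (Fin 4)) 1) : EuclideanSpace ℝ (Fin 4)) < 1 / 4) → Literature.Topology.FourManifolds.RegularSublevel.incl hΦ (D₂.jA w) = G.jN w) ∧ (∀ (j : ι') (b : ↥(Literature.Topology.FourManifolds.beltPiece 3 2)), Literature.Topology.FourManifolds.RegularSublevel.incl hΦ (D₂.jB j b) = Summit.SmoothPoincare4.SmoothPoincare4.Theorems.AcyclicBisectionExists.ModpBraidOrbits.gluedHandleChart D (f j) G a (Summit.SmoothPoincare4.SmoothPoincare4.Theorems.AcyclicBisectionExists.ModpBraidOrbits.modelF a κ δ ((b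 : Metric.closedBall (0 : EuclideanSpace ℝ (Fin 4)) 1) : EuclideanSpace ℝ (Fin 4)))))
    (HST4 : ∀ (g : ℕ) (l : List ((Fin g ⊕ Fin g → ℤ) × Bool)) (h : Fin l.length → HandleAttachingMap 3 2 (Base g)) (hlink : IsLefschetzLink g l h) {X : Type} [TopologicalSpace X] [T2Space X] [SecondCountableTopology X] [CompactSpace X] [ChartedSpace (EuclideanHalfSpace 4) X] [IsManifold (𝓡∂ 4) ∞ X] (D : MultiAttachmentData h (𝓡∂ 4) X) (bX : BoundaryData (𝓡∂ 4) X (𝓡 3)) (Ψ : bX.carrier ≃ₘ⟮𝓡 3, 𝓡 3⟯ (bBase g).carrier) (hpage : ∀ (y : bX.carrier) (a : ↥(coresComplement h)), bX.incl y = D.jA a → ∃ c : ℝ, 0 < c ∧ w g ((bBase g).incl (Ψ y)).1 = (c : ℂ) * w g (a : Base g).1), ∃ s₀ : ℤ, (s₀ = 1 ∨ s₀ = -1) ∧ ∀ (c : ℂ) (_ : ‖c‖ = 1) (K : sphere (0 : EuclideanSpace ℝ (Fin 2)) 1 → Base g) (ν : sphere (0 : EuclideanSpace ℝ (Fin 2))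 1 → EuclideanSpace ℝ (Fin 4)) (hK : ∀ θ, K θ ∈ coresComplement h) (_ : ∀ θ, K θ ∈ page g c) (_ : IsBoundaryKnot K) (_ : IsKnotFraming K ν) (z : sphere (0 : EuclideanSpace ℝ (Fin 2)) 1 → bX.carrier) (_ : ∀ θ, bX.incl (z θ) = D.jA ⟨K θ, hK θ⟩) (u : sphere (0 : EuclideanSpace ℝ (Fin 2)) 1 → EuclideanSpace ℝ (Fin 3)) (_ : ∀ θ, mfderiv (𝓡 3) (𝓡∂ 4) bX.incl (z θ) (u θ) = mfderiv (𝓡∂ 4) (𝓡∂ 4) (fun a : ↥(coresComplement h) => D.jA a) ⟨K θ, hK θ⟩ (ν θ)) (R : AmbientIsotopy (𝓡∂ 4) (Base g)) (_ : ∀ (t : ℝ) (x : Base g), rho g (R.toFun t x).1 = rho g x.1) (_ : ∀ (t : ℝ) (x : Base g), ∃ r : ℝ, 0 < r ∧ w g (R.toFun t x).1 = (r : ℂ) * w g x.1) (_ : ∀ θ, R.toFun 1 ((bBase g).incl (Ψ (z θ))) ∈ page g c), pageTwisting g (R.toFun 1 ∘ fun θ => ((bBase g).incl (Ψ (z θ))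 : Base g)) (fun θ => mfderiv (𝓡∂ 4) (𝓡∂ 4) (R.toFun 1) ((bBase g).incl (Ψ (z θ))) (mfderiv (𝓡 3) (𝓡∂ 4) (fun y => ((bBase g).incl (Ψ y) : Base g)) (z θ) (u θ))) = s₀ * pageTwisting g K ν)
    (Hgap : ∀ (g : ℕ) (P N : List ((Fin g ⊕ Fin g → ℤ) × Bool)) (h : Fin (P ++ N).length → HandleAttachingMap 3 2 (Base g)) (hlink : IsLefschetzLink g (P ++ N) h) {X : Type} [TopologicalSpace X] [T2Space X] [SecondCountableTopology X] [CompactSpace X] [ChartedSpace (EuclideanHalfSpace 4) X] [IsManifold (𝓡∂ 4) ∞ X] (D : MultiAttachmentData h (𝓡∂ 4) X) (bX : BoundaryData (𝓡∂ 4) X (𝓡 3)) (Ψ : bX.carrier ≃ₘ⟮𝓡 3, 𝓡 3⟯ (bBase g).carrier) (hpage : ∀ (y : bX.carrier) (a : ↥(coresComplement h)), bX.incl y = D.jA a → ∃ c : ℝ, 0 < c ∧ w g ((bBase g).incl (Ψ y)).1 = (c : ℂ) * w g (a : Base g).1) {X₁ : Type} [TopologicalSpace X₁] [T2Space X₁]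 [SecondCountableTopology X₁] [CompactSpace X₁] [ChartedSpace (EuclideanHalfSpace 4) X₁] [IsManifold (𝓡∂ 4) ∞ X₁] (D₁ : MultiAttachmentData (fun i : Fin P.length => h (Fin.cast List.length_append.symm (Fin.castAdd N.length i))) (𝓡∂ 4) X₁) {W₂ : Type} [TopologicalSpace W₂] [T2Space W₂] [SecondCountableTopology W₂] [CompactSpace W₂] [ChartedSpace (EuclideanHalfSpace 4) W₂] [IsManifold (𝓡∂ 4) ∞ W₂] (b₂ : BoundaryData (𝓡∂ 4) W₂ (𝓡 3)) (φ : (BoundaryManifold.boundaryData 3 X₁).carrier ≃ₘ⟮𝓡 3, 𝓡 3⟯ b₂.carrier) (col : (BoundaryManifold.boundaryData 3 (Base g)).Collar) (κ δ : ℝ) (hκ : 0 < κ) (hκ1 : κ ≤ 1) (hδ : 0 < δ) (hδ2 : δ ≤ 1 / 2) (D₂ : MultiAttachmentData (fun j : Fin N.length => dualMap D bX (bBase g) Ψ col κ δ hκ hκ1 hδ hδ2 (Fin.cast List.length_append.symm (Fin.natAdd P.length j))) (𝓡∂ 4) W₂) (hseam : ∀ (y : (BoundaryManifold.boundaryData 3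 X₁).carrier) (a : ↥(coresComplement h)) (ha₁ : (a : Base g) ∈ coresComplement (fun i : Fin P.length => h (Fin.cast List.length_append.symm (Fin.castAdd N.length i)))) (z : bX.carrier) (hz : D.jA a = bX.incl z), (BoundaryManifold.boundaryData 3 X₁).incl y = D₁.jA ⟨a, ha₁⟩ → (∀ (j : Fin N.length) (t : ↥(handleTube 3 2)), (h (Fin.cast List.length_append.symm (Fin.natAdd P.length j))).toFun t = (a : Base g) → ‖lamPart ((t : closedBall (0 : EuclideanSpace ℝ (Fin 4)) 1) : EuclideanSpace ℝ (Fin 4))‖ ^ 2 ≤ 1 - 3 * κ ^ 2 / 4) → b₂.incl (φ y) = D₂.jA ⟨(bBase g).incl (Ψ z), incl_mem_coresComplement_dualMap D bX (bBase g) Ψ col κ δ hκ hκ1 hδ hδ2 (fun j : Fin N.length => Fin.cast List.length_append.symm (Fin.natAdd P.length j)) z a hz⟩) (s' : Bool) (h' : Fin N.length → HandleAttachingMap 3 2 (Base g)) (_ : ∀ j, ∃ c : ℂ, ‖c‖ = 1 ∧ ∀ θ, (h' j).attachingCircle θ ∈ page g c) (_ : ∀ j, shadow g (h' j).attachingCircle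 (h' j).continuous_attachingCircle ≠ 0) (_ : ∀ j, pageTwisting g (h' j).attachingCircle (h' j).attachingFraming = if s' then -1 else 1) (_ : Pairwise fun i j => Disjoint (range (h' i).toFun) (range (h' j).toFun)) (_ : HandleAttachingMap.IsMultiAttachment h' (𝓡∂ 4) W₂), ∃ (q₂ : Fin N.length → HandleAttachingMap 3 2 (Base g)) (D₂p : MultiAttachmentData q₂ (𝓡∂ 4) W₂) (s : Bool), (∀ j, ∃ c : ℂ, ‖c‖ = 1 ∧ ∀ θ, (q₂ j).attachingCircle θ ∈ page g c) ∧ (∀ j, shadow g (q₂ j).attachingCircle (q₂ j).continuous_attachingCircle ≠ 0) ∧ (∀ j, pageTwisting g (q₂ j).attachingCircle (q₂ j).attachingFraming = if s then -1 else 1) ∧ (∃ (y₀ : (BoundaryManifold.boundaryData 3 X₁).carrier) (a₁ : ↥(coresComplement (fun i : Fin P.length => h (Fin.cast List.length_append.symm (Fin.castAdd N.length i))))) (a₂ : ↥(coresComplement q₂)), (BoundaryManifold.boundaryData 3 X₁).incl y₀ = D₁.jA a₁ ∧ b₂.incl (φ y₀) = D₂p.jA a₂ ∧ ∀ (uu :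 Fin 3 → EuclideanSpace ℝ (Fin 3)) (v₁ v₂ : Fin 3 → EuclideanSpace ℝ (Fin 4)), (∀ k, mfderiv (𝓡 3) (𝓡∂ 4) (BoundaryManifold.boundaryData 3 X₁).incl y₀ (uu k) = mfderiv (𝓡∂ 4) (𝓡∂ 4) D₁.jA a₁ (v₁ k)) → (∀ k, mfderiv (𝓡 3) (𝓡∂ 4) (b₂.incl ∘ φ) y₀ (uu k) = mfderiv (𝓡∂ 4) (𝓡∂ 4) D₂p.jA a₂ (v₂ k)) → IsPosBdryFrame (fun i : Fin P.length => h (Fin.cast List.length_append.symm (Fin.castAdd N.length i))) a₁ v₁ → 0 < (if s then (1 : ℝ) else -1) * det4 (gradient (rho g) (a₂ : Base g).1) (ambientC q₂ a₂ (v₂ 0)) (ambientC q₂ a₂ (v₂ 1)) (ambientC q₂ a₂ (v₂ 2))) ∧ (∀ ap : ↥(coresComplement q₂), ∃ (a' : ↥(coresComplement (fun j : Fin N.length => dualMap D bX (bBase g) Ψ col κ δ hκ hκ1 hδ hδ2 (Fin.cast List.length_append.symm (Fin.natAdd P.length j))))) (c : ℝ), 0 < c ∧ D₂p.jA ap = D₂.jA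 a' ∧ w g (ap : Base g).1 = (c : ℂ) * w g (a' : Base g).1) ∧ (∀ a' : ↥(coresComplement (fun j : Fin N.length => dualMap D bX (bBase g) Ψ col κ δ hκ hκ1 hδ hδ2 (Fin.cast List.length_append.symm (Fin.natAdd P.length j)))), ∃ ap : ↥(coresComplement q₂), D₂p.jA ap = D₂.jA a'))
    (HF : ∀ {g : ℕ} {ι : Type} [Finite ι] {h : ι → HandleAttachingMap 3 2 (Base g)} {X : Type} [TopologicalSpace X] [ChartedSpace (EuclideanHalfSpace 4) X] [IsManifold (𝓡∂ 4) ∞ X] {bX : BoundaryData (𝓡∂ 4) X (𝓡 3)} [Nonempty bX.carrier] {ι₁ : Type} [Finite ι₁] {ι' : Type} [Finite ι'] {X₁ : Type} [TopologicalSpace X₁] [T2Space X₁] [CompactSpace X₁] [ChartedSpace (EuclideanHalfSpace 4) X₁] [IsManifold (𝓡∂ 4) ∞ X₁] {W₂ : Type} [TopologicalSpace W₂] [ChartedSpace (EuclideanHalfSpace 4) W₂] [IsManifold (𝓡∂ 4) ∞ W₂] (D : MultiAttachmentData h (𝓡∂ 4) X) (G : BoundaryGlueData bX (bBase g)) (e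 : ι₁ → ι) (f : ι' → ι) (hf : Injective f) (hef : ∀ i, i ∈ range e ∨ i ∈ range f) (hdisj : ∀ (j : ι') (i : ι₁), Disjoint (range (h (f j)).toFun) (range (h (e i)).toFun)) (D₁ : MultiAttachmentData (fun i => h (e i)) (𝓡∂ 4) X₁) (D₂' : MultiAttachmentData (fun j => D₁.lift (h (f j)) (hdisj j)) (𝓡∂ 4) X) (hA : ∀ (a : ↥(coresComplement h)) (ha₁ : (a : Base g) ∈ coresComplement fun i => h (e i)) (ha₂ : D₁.jA ⟨a, ha₁⟩ ∈ coresComplement fun j => D₁.lift (h (f j)) (hdisj j)), D₂'.jA ⟨D₁.jA ⟨a, ha₁⟩, ha₂⟩ = D.jA a) (hB : ∀ (i : ι₁) (b : ↥(beltPiece 3 2)) (hb : D₁.jB i b ∈ coresComplement fun j => D₁.lift (h (f j)) (hdisj j)), D₂'.jA ⟨D₁.jB i b, hb⟩ = D.jB (e i) b) (hC : ∀ (j : ι') (b : ↥(beltPiece 3 2)), D₂'.jB j b = D.jB (f j) b) {aC κ δ : ℝ} (ha : 0 < aC) (hκ : 0 < κ) (hκ2 : κ ≤ 1 / 2) (hκ1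 : κ ≤ 1) (hδ : 0 < δ) (hδ2 : δ ≤ 1 / 2) (col : (BoundaryManifold.boundaryData 3 (Base g)).Collar) (hCM : ∀ j, CollarAdapted D (f j) G aC) (hcol : ∀ (w : (BoundaryManifold.boundaryData 3 (Base g)).carrier) (x : (bBase g).carrier), (BoundaryManifold.boundaryData 3 (Base g)).incl w = (bBase g).incl x → ∀ t : Set.Icc (0 : ℝ) 1, col.toFun (w, t) = G.CN.toFun x ((t : ℝ) / (2 - t))) {jX₁ : X₁ → G.d₂.Glued} (hYa : ∀ (p : X₁) (hp : p ∈ coresComplement fun j => D₁.lift (h (f j)) (hdisj j)), (∀ (j : ι') (y : ↥(handleTube 3 2)), (D₁.lift (h (f j)) (hdisj j)).toFun y = p → ‖lamPart ((y : closedBall (0 : EuclideanSpace ℝ (Fin 4)) 1) : EuclideanSpace ℝ (Fin 4))‖ ^ 2 ≤ 1 - 3 * κ ^ 2 / 4) → jX₁ p = G.jM (D₂'.jA ⟨p, hp⟩)) (hYb : ∀ (j : ι') (y : ↥(handleTube 3 2)) (b : ↥(beltPiece 3 2)), ((b : closedBall (0 : EuclideanSpace ℝ (Fin 4)) 1) :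 EuclideanSpace ℝ (Fin 4)) = handleInversion 2 (PushModel.selfPush κ δ ((y : closedBall (0 : EuclideanSpace ℝ (Fin 4)) 1) : EuclideanSpace ℝ (Fin 4))) → jX₁ ((D₁.lift (h (f j)) (hdisj j)).toFun y) = G.jM (D₂'.jB j b)) (b₂ : BoundaryData (𝓡∂ 4) W₂ (𝓡 3)) {jW₂ : W₂ → G.d₂.Glued} (hjW₂ : Injective jW₂) (φ : (BoundaryManifold.boundaryData 3 X₁).carrier ≃ₘ⟮𝓡 3, 𝓡 3⟯ b₂.carrier) (hseamId : ∀ z, jW₂ (b₂.incl (φ z)) = jX₁ ((BoundaryManifold.boundaryData 3 X₁).incl z)) (D₂ : MultiAttachmentData (fun j : ι' => dualMap D bX (bBase g) G.φ col κ δ hκ hκ1 hδ hδ2 (f j)) (𝓡∂ 4) W₂) (hE1 : ∀ (w : Base g) (hw : w ∈ coresComplement fun j : ι' => dualMap D bX (bBase g) G.φ col κ δ hκ hκ1 hδ hδ2 (f j)), (∀ (j : ι') (y : ↥(handleTube 3 2)), (dualMap D bX (bBase g) G.φ col κ δ hκ hκ1 hδ hδ2 (f j)).toFun y ≠ w) →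 jW₂ (D₂.jA ⟨w, hw⟩) = G.jN w) (hF1 : ∀ (j : ι') (zb b : ↥(beltPiece 3 2)), ((b : closedBall (0 : EuclideanSpace ℝ (Fin 4)) 1) : EuclideanSpace ℝ (Fin 4)) = modelF aC κ δ ((zb : closedBall (0 : EuclideanSpace ℝ (Fin 4)) 1) : EuclideanSpace ℝ (Fin 4)) → jW₂ (D₂.jB j zb) = G.jM (D.jB (f j) b)) (hpage : ∀ (y : bX.carrier) (a : ↥(coresComplement h)), bX.incl y = D.jA a → ∃ c : ℝ, 0 < c ∧ w g ((bBase g).incl (G.φ y)).1 = (c : ℂ) * w g (a : Base g).1) (hbelt : ∀ (y : bX.carrier) (k : ι) (b : ↥(beltPiece 3 2)), bX.incl y = D.jB k b → bX.incl y ∉ range D.jA → w g ((bBase g).incl (G.φ y)).1 ≠ 0), ∃ F : (BoundaryManifold.boundaryData 3 X₁).carrier → ℂ, ContMDiff (𝓡 3) 𝓘(ℝ, ℂ) ∞ F ∧ (∀ (y : (BoundaryManifold.boundaryData 3 X₁).carrier) (a : ↥(coresComplement fun i => h (e i))), (BoundaryManifold.boundaryData 3 X₁).incl y = D₁.jA a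 → ∃ c : ℝ, 0 < c ∧ F y = c * w g (a : Base g).1) ∧ (∀ (y : (BoundaryManifold.boundaryData 3 X₁).carrier) (a' : ↥(coresComplement fun j : ι' => dualMap D bX (bBase g) G.φ col κ δ hκ hκ1 hδ hδ2 (f j))), b₂.incl (φ y) = D₂.jA a' → ∃ c : ℝ, 0 < c ∧ F y = c * w g (a' : Base g).1) ∧ (∀ y, F y = 0 → ∃ a : ↥(coresComplement fun i => h (e i)), (BoundaryManifold.boundaryData 3 X₁).incl y = D₁.jA a) ∧ (∀ y, F y ≠ 0 → ∃ v : EuclideanSpace ℝ (Fin 3), ((starRingEnd ℂ) (F y) * @id ℂ (mfderiv (𝓡 3) 𝓘(ℝ, ℂ) F y v)).im ≠ 0)) :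
    ∀ (M : Type) [TopologicalSpace M] [T2Space M] [SecondCountableTopology M] [ChartedSpace (EuclideanSpace ℝ (Fin 4)) M] [IsManifold (𝓡 4) ∞ M] (g : ℕ) (P N : List ((Fin g ⊕ Fin g → ℤ) × Bool)), Literature.Topology.FourManifolds.LefschetzBase.ModelsOnFibred M g (P ++ N) → (∀ x ∈ N, x.2 = false) → (∀ x ∈ P ++ N, x.1 ≠ 0) → ∃ (h : Fin (P ++ N).length → Literature.Topology.FourManifolds.HandleAttachingMap 3 2 (Literature.Topology.FourManifolds.LefschetzBase.Base g)) (X₁ : Type) (_ : TopologicalSpace X₁) (_ : T2Space X₁) (_ : SecondCountableTopology X₁) (_ : CompactSpace X₁) (_ : ChartedSpace (EuclideanHalfSpace 4) X₁) (_ : IsManifold (𝓡∂ 4) ∞ X₁) (D₁ : Literature.Topology.FourManifolds.HandleAttachingMap.MultiAttachmentData (fun i : Fin P.length => h (Fin.cast List.length_append.symm (Fin.castAdd N.length i))) (𝓡∂ 4) X₁) (W₂ : Type) (_ : TopologicalSpace W₂) (_ : ChartedSpace (EuclideanHalfSpace 4) W₂) (_ : IsManifold (𝓡∂ 4) ∞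 W₂) (_ : CompactSpace W₂) (_ : T2Space W₂) (_ : SecondCountableTopology W₂) (b₁ : Literature.Topology.FourManifolds.BoundaryData (𝓡∂ 4) X₁ (𝓡 3)) (b₂ : Literature.Topology.FourManifolds.BoundaryData (𝓡∂ 4) W₂ (𝓡 3)) (φ : b₁.carrier ≃ₘ⟮𝓡 3, 𝓡 3⟯ b₂.carrier) (h₂ : Fin N.length → Literature.Topology.FourManifolds.HandleAttachingMap 3 2 (Literature.Topology.FourManifolds.LefschetzBase.Base g)) (D₂ : Literature.Topology.FourManifolds.HandleAttachingMap.MultiAttachmentData h₂ (𝓡∂ 4) W₂) (F : b₁.carrier → ℂ), Literature.Topology.FourManifolds.LefschetzBase.IsLefschetzLink g (P ++ N) h ∧ Literature.Topology.FourManifolds.IsBoundaryGluing b₁ b₂ φ (𝓡 4) M ∧ (∀ j, ∃ c : ℂ, ‖c‖ = 1 ∧ ∀ θ, (h₂ j).attachingCircle θ ∈ Literature.Topology.FourManifolds.LefschetzBase.page g c) ∧ (∀ j, Literature.Topology.FourManifolds.LefschetzBase.shadow g (h₂ j).attachingCircle (h₂ j).continuous_attachingCircle ≠ 0) ∧ (∀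 j, Literature.Topology.FourManifolds.LefschetzBase.pageTwisting g (h₂ j).attachingCircle (h₂ j).attachingFraming = -1) ∧ ContMDiff (𝓡 3) 𝓘(ℝ, ℂ) ∞ F ∧ (∀ y a, b₁.incl y = D₁.jA a → ∃ c : ℝ, 0 < c ∧ F y = c * Literature.Topology.FourManifolds.LefschetzBase.w g a.1.1) ∧ (∀ y a', b₂.incl (φ y) = D₂.jA a' → ∃ c : ℝ, 0 < c ∧ F y = c * Literature.Topology.FourManifolds.LefschetzBase.w g a'.1.1) ∧ (∀ y, F y = 0 → ∃ a, b₁.incl y = D₁.jA a) ∧ (∀ y, F y ≠ 0 → ∃ v : EuclideanSpace ℝ (Fin 3), ((starRingEnd ℂ) (F y) * @id ℂ (mfderiv (𝓡 3) 𝓘(ℝ, ℂ) F y v)).im ≠ 0) ∧ (∀ y a, b₁.incl y = D₁.jA a → Literature.Topology.FourManifolds.LefschetzBase.w g a.1.1 = 0 → ∃ a', b₂.incl (φ y) = D₂.jA a') ∧ (∃ (y : b₁.carrier) (a₁ : Literature.Topology.FourManifolds.HandleAttachingMap.coresComplement (fun i : Fin P.length => h (Fin.cast List.length_append.symm (Fin.castAdd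 N.length i)))) (a₂ : Literature.Topology.FourManifolds.HandleAttachingMap.coresComplement h₂) (uu : Fin 3 → EuclideanSpace ℝ (Fin 3)) (v₁ v₂ : Fin 3 → EuclideanSpace ℝ (Fin 4)), b₁.incl y = D₁.jA a₁ ∧ b₂.incl (φ y) = D₂.jA a₂ ∧ (∀ k, mfderiv (𝓡 3) (𝓡∂ 4) b₁.incl y (uu k) = mfderiv (𝓡∂ 4) (𝓡∂ 4) D₁.jA a₁ (v₁ k)) ∧ (∀ k, mfderiv (𝓡 3) (𝓡∂ 4) (b₂.incl ∘ φ) y (uu k) = mfderiv (𝓡∂ 4) (𝓡∂ 4) D₂.jA a₂ (v₂ k)) ∧ Literature.Geometry.Symplectic.IsPosBdryFrame (fun i : Fin P.length => h (Fin.cast List.length_append.symm (Fin.castAdd N.length i))) a₁ v₁ ∧ Literature.Geometry.Symplectic.IsPosBdryFrame h₂ a₂ v₂) ∧ ConnectedSpace b₁.carrier :=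
  T3_of_pieces Hiv HST4 Hgap helper_dualPresentation_signPin HF T3_bind helper_T3_connected

/-! ### §4 Registered helper -/

/-- **Sub-goal `helper_mem_range_prefix_or_suffix` of stub `stub_T3_dualPresentation`** (T3 assembly
bookkeeping; wave 5, lead c5): every index of `P ++ N` is a prefix or a suffix index
(`mem_range_prefix_or_suffix`, fully qualified registered text). [folklore] -/
theorem helper_mem_range_prefix_or_suffix : ∀ {α : Type} (P N : List α) (i : Fin (P ++ N).length), i ∈ Set.range (fun i : Fin P.length => Fin.cast List.length_append.symm (Fin.castAdd N.length i)) ∨ i ∈ Set.range (fun j : Fin N.length => Fin.cast List.length_append.symm (Fin.natAdd P.length j)) :=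
  fun P N i => mem_range_prefix_or_suffix P N i

end Summit.SmoothPoincare4.SmoothPoincare4.Theorems.AcyclicBisectionExists.ModpBraidOrbits

end
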